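import Mathlib
import HarnessLib
import Literature.Combinatorics.Additive.NearlyPeriodicSummands

/-!
# Grynkiewicz 2009, Lemma 5.7: a summand one element away from quasi-periodic
# (`d⊆(A, QP) = 1` with `|A| ≥ 4` or `|B| ≥ 4` forces `d⊆(C, QP) = 1` for the six sets and (17))

Topic `Literature/Combinatorics/Additive`.  Cell `mm-stpp` (D-0046), seat `mm-stpp-lit` (gen 22).
Fifth file of the port of

* D. J. Grynkiewicz, *A step beyond Kemperman's structure theorem*, Mathematika **55** (2009)
  67–114, doi 10.1112/S0025579300000966 [Grynkiewicz2009] — held as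
  `paper:doi-10-1112-s0025579300000966` (print numbering; read at pp. 16–20 this session),

after `SumsetVersusDifferenceSet.lean` (Thm 3.1), `QuasiPeriodicDecompositions.lean` (§2, Props 2.1–2.4,
Lemmas 5.1–5.4, Prop 5.5, Lemma 5.11, Lemma 5.6 up to Case 1), `QuasiProgressions.lean` (`c_d`, `QAP_d`,
`d⊆`, Lemma 5.8) and `NearlyPeriodicSummands.lean` (Lemma 5.6 complete: (17) and `d⊆(C, QP) = 1`).
Everything here is PROVED (theorems only; 0 `sorry`, 0 definitions, 0 named facts).

## What is formalized

PRINT (Lemma 5.7, p. 18): "Let `A` and `B` be nonempty subsets of a finite abelian group `G` with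
`|A + B| = |A| + |B|`, `0 ∈ A ∩ B`, `|A|, |B|, d⊆(A + B, P) ≥ 3`, `(A, B)` non-extendible, and `⟨A⟩ = G`.
If `d⊆(A, QP) = 1` and either `|A| ≥ 4` or `|B| ≥ 4`, then `d⊆(C, QP) = 1` for all
`C ∈ {A, B, A + B, Ā, B̄, \overline{A + B}}` and (17) holds."  Here (17) (print p. 10) is
"`|(A ∪ {α}) + (B ∪ {β})| = |A ∪ {α}| + |B ∪ {β}| − 1` for some `α, β`".

* **`Grynkiewicz2009.subsetDist_eq_one_and_seventeen_of_subsetDist_eq_one`** — Lemma 5.7 as printed,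
  with `d⊆(A, QP) = 1` as `subsetDist A {P | IsQuasiPeriodic P} = 1`; and
  **`Grynkiewicz2009.subsetDist_eq_one_and_seventeen_of_insert_isQuasiPeriodic`** — the same with that
  hypothesis unfolded as "`A` not quasi-periodic, `A ∪ {α}` quasi-periodic for some `α ∉ A`"
  (`subsetDist_eq_one_iff`).  Rendering as in `NearlyPeriodicSummands.lean`: `d⊆(A + B, P) ≥ 3` is
  "every periodic superset of `A + B` has at least three more elements"
  (`∀ P ⊇ A + B, P.addStab ≠ {0} → 3 ≤ |P ∖ (A + B)|`), the six sets are a `∀` over the six-element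
  `Finset (Finset G)` (bars = complements in the finite group), (17) is
  `|(A ∪ {α}) + (B ∪ {β})| + 1 = |A ∪ {α}| + |B ∪ {β}|` in `ℕ`.
* The printed proof (pp. 19–20), step by step:
  `shape_of_insert_isQuasiPeriodic` ("the proof is complete unless `A = A₁ ∪ A₀` with each `A_i` a subset
  of an `H`-coset and `|A₁| = |H| − 1`"; otherwise Lemma 5.6, applied through
  `lemma56_of_periodic_union`, which passes to the maximal period of the periodic part);
  "If `A₀` is empty, then `⟨A⟩ = G` implies that `H = G` …"; "`|H| ≥ 3`"; Lemma 5.4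
  (`not_isQuasiPeriodic_six`); the singletons `b₁, …, b_c` / the rest `B′` / the holes `ρ′`
  (`mem_singletons_iff`, `coset_subset_add_of_notMem_singletons`, `card_add_coset_eq_of_singletons`);
  **Case 1** `|φ_H(A) + φ_H(B)| ≥ |φ_H(B)| + 1`: display (35) `case_one_count`, its case analysis
  `case_one_shape_of_rho_zero` / `case_one_shape_of_rho_one` / `case_one_core` (the exits "covered by
  Lemma 5.6" go through `lemma56_of_periodic_union` for the pair `(B, A)`), and the final two-coset
  configuration `case_one_two_by_two` / `case_one_structure` (`|A₀| = 1`, `A₀ + B₁ = A₁ + B₀`,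
  `|A₁ + B₁| = |H|`, the holes `α`, `β` and "(A ∪ {α}) + (B ∪ {β}) = (A + B) ∪ {one element}");
  **Case 2** `|φ_H(A) + φ_H(B)| = |φ_H(B)|` is impossible: `case_two_cover` ("`K = G` and `G/H` is cyclic
  generated by `φ_H(A₁) − φ_H(A₀)`", rendered as: `B` meets every `H`-coset), display (36)
  `case_two_count`, `case_two_l_pos` ("Suppose `l > 0` …"), `case_two_l_zero_numbers` /
  `case_two_l_zero` ("`l = 0` … `A + B + {b₁, b₂} = A + B + b₁`, implying from Kneser's Theorem that
  `A + B` is periodic"), `case_two_false`.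
* Bookkeeping: `subsetDist_eq_one_iff` (`d⊆(A, 𝒮) = 1 ↔ A ∉ 𝒮 ∧ ∃ β ∉ A, A ∪ {β} ∈ 𝒮`),
  `forall_of_add_invariant` (a coset walk: in a finite group with `⟨d⟩ + K = G`, a property stable under
  `+d` and `+K` that holds somewhere holds everywhere), `coset_subset_add_of_pair`,
  `eq_hole_of_notMem_add`, `mem_six_comm`.

## Deviations from print (all flagged in the docstrings)

* The Case-1/Case-2 dichotomy "`|φ_H(A) + φ_H(B)| ≥ |φ_H(B)| + 1`" vs "`= |φ_H(B)|`" is carried, without the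
  quotient group, as "some coset `a₀ + b + H` (`b ∈ B`) is none of the cosets `α + b′ + H` (`b′ ∈ B`)" vs
  its negation (`φ_H(A) = {φ_H(α), φ_H(a₀)}` and `φ_H(A₁) + φ_H(B) = φ_H(α) + φ_H(B)` has `|φ_H(B)|`
  elements, so these are the printed cases).
* In Case 2 print invokes Kneser's theorem in `G/H` to get "`φ_H(B)` is `K/H`-periodic … `K = G`"; here
  the same conclusion (`B` meets every `H`-coset) is obtained directly: the set of cosets met by `B` is
  stable under adding `a₀ − α` (the Case-2 hypothesis) and `⟨a₀ − α⟩ + H = G` (from `⟨A⟩ = G`,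
  `0 ∈ A`), a coset walk from `0 ∈ B` — a shorter road to the printed statement, not a different theorem.
  The final Kneser step of Case 2 is kept (tree `card_add_card_le_card_add_add_card_addStab`).
* In the last sub-case of Case 1 print gets `|A₀| = 1` "by the above argument as well" (the Case-1
  count for the pair `(B, A)`); here `|A₀| = 1`, `A₀ + B₁ = A₁ + B₀` and `|A₁ + B₁| = |H|` are read off
  one count of the four blocks `A_i + B_j` of `A + B` (the count print performs in the next sentence).
* Subgroups are carried as finsets `Hf` with `∀ g, g ∈ Hf ↔ g ∈ H` (the tree's convention); the
  singleton set `S = {b₁, …, b_c}` and `S^× = {b_i : A₁ + b_i + H ⊄ A + B}` are passed between the lemmas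
  through membership characterizations (no new definitions).
* `|A| ≥ 3` is used only through `|H| ≥ 3`; "`B` nonempty" follows from `0 ∈ B`.
  `-- TODO(general form): none — the lemma is stated for finite `G` in print.`

WHAT THIS FILE IS NOT: not the Kemperman-structure bridge nor Lemmas 5.9/5.10, Theorem 4.1, §6
(successor work).  Census-silent Literature shelf: no row, bracket, threshold or verdict word of the cell
moves; no `ω`.

## References
* D. J. Grynkiewicz, *A step beyond Kemperman's structure theorem*, Mathematika 55 (2009) 67–114,
  doi:10.1112/S0025579300000966 — Lemma 5.4 (p. 16), Lemma 5.6 (pp. 17–18), Lemma 5.7 and its proof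
  (pp. 18–20), displays (17), (35), (36) [cite: Grynkiewicz2009, Lemma 5.7].
* M. Kneser, *Abschätzung der asymptotischen Dichte von Summenmengen*, Math. Z. 58 (1953) 459–484 —
  used through the tree's `Kneser.lean` [cite: Kneser1953].
-/

namespace Literature.Combinatorics.Additive

open Finset
open scoped Pointwise

variable {G : Type*} [AddCommGroup G] [DecidableEq G]

namespace Grynkiewicz2009

/-! ### Bookkeeping: `d⊆(A, 𝒮) = 1`, cosets carried as finsets, coset walks -/

section SubsetDistOne

variable {α : Type*} [DecidableEq α]

omit [AddCommGroup G] [DecidableEq G] in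
/-- `d⊆(A, 𝒮) = 1` unfolded: `A ∉ 𝒮` and `A ∪ {β} ∈ 𝒮` for some `β ∉ A` (print p. 1: "`d⊆(A, B) = |B ∖ A|`
if `A ⊆ B` … `d⊆(A, 𝒮) = min_{B ∈ 𝒮} d⊆(A, B)`"; the hypothesis "`d⊆(A, QP) = 1`" of Lemma 5.7 in the
form it is used). [cite: Grynkiewicz2009, §1] -/
theorem subsetDist_eq_one_iff {A : Finset α} {𝒮 : Set (Finset α)} :
    subsetDist A 𝒮 = 1 ↔ A ∉ 𝒮 ∧ ∃ β ∉ A, insert β A ∈ 𝒮 := by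
  constructor
  · intro h
    have hA : A ∉ 𝒮 := fun hA => by
      have h0 := subsetDist_eq_zero_iff.2 hA
      rw [h] at h0
      exact one_ne_zero h0
    refine ⟨hA, ?_⟩
    have hlt : subsetDist A 𝒮 < 2 := by
      rw [h]; exact_mod_cast (by norm_num : (1 : ℕ) < 2)
    unfold subsetDist at hlt
    simp only [iInf_lt_iff] at hlt
    obtain ⟨B, hB, hAB, hcard⟩ := hlt
    have h1 : (1 : ℕ∞) ≤ #(B \ A) := by rw [← h]; exact subsetDist_le hB hAB
    have hc : #(B \ A) = 1 := by
      have h1' : 1 ≤ #(B \ A) := by exact_mod_cast h1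
      have h2' : #(B \ A) < 2 := by exact_mod_cast hcard
      omega
    obtain ⟨β, hβ⟩ := card_eq_one.1 hc
    have hβmem : β ∈ B \ A := by rw [hβ]; exact mem_singleton_self β
    refine ⟨β, (mem_sdiff.1 hβmem).2, ?_⟩
    have : insert β A = B := by rw [insert_eq, ← union_sdiff_of_subset hAB, hβ, union_comm]
    rw [this]; exact hB
  · rintro ⟨hA, β, hβ, hins⟩
    exact subsetDist_eq_one hA hβ hins

end SubsetDistOne

/-- `s + {b} = b + s`. [folklore] -/
private theorem add_singleton_eq_vadd (s : Finset G) (b : G) : s + {b} = b +ᵥ s := by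
  ext y
  constructor
  · intro hy
    obtain ⟨x, hx, z, hz, rfl⟩ := mem_add.1 hy
    rw [mem_singleton] at hz
    subst hz
    exact mem_vadd_finset.2 ⟨x, hx, by rw [vadd_eq_add, add_comm]⟩
  · intro hy
    obtain ⟨x, hx, rfl⟩ := mem_vadd_finset.1 hy
    exact mem_add.2 ⟨x, hx, b, mem_singleton_self b, by rw [vadd_eq_add, add_comm]⟩

/-- Membership in a coset carried as a finset: `x ∈ c + Hf ↔ x − c ∈ H`. [folklore] -/
private theorem mem_coset_iff {H : AddSubgroup G} {Hf : Finset G} (hHf : ∀ g, g ∈ Hf ↔ g ∈ H)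
    {x c : G} : x ∈ c +ᵥ Hf ↔ x - c ∈ H := by
  rw [← neg_vadd_mem_iff, hHf, vadd_eq_add, neg_add_eq_sub]

/-- Sum of subsets of two cosets lies in the sum coset. [folklore] -/
private theorem add_subset_coset {H : AddSubgroup G} {Hf X Y : Finset G} (hHf : ∀ g, g ∈ Hf ↔ g ∈ H)
    {x y : G} (hX : X ⊆ x +ᵥ Hf) (hY : Y ⊆ y +ᵥ Hf) : X + Y ⊆ (x + y) +ᵥ Hf := by
  intro z hz
  obtain ⟨u, hu, v, hv, rfl⟩ := mem_add.1 hz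
  have hu' := (mem_coset_iff hHf).1 (hX hu)
  have hv' := (mem_coset_iff hHf).1 (hY hv)
  refine (mem_coset_iff hHf).2 ?_
  have e : u + v - (x + y) = (u - x) + (v - y) := by abel
  rw [e]; exact H.add_mem hu' hv'

/-- A coset carried as a finset is `H`-periodic. [folklore] -/
private theorem isPeriodicWith_coset {H : AddSubgroup G} {Hf : Finset G} (hHf : ∀ g, g ∈ Hf ↔ g ∈ H)
    (c : G) : IsPeriodicWith H (c +ᵥ Hf) := fun h hh => by
  rw [vadd_vadd, add_comm, ← vadd_vadd, vadd_finset_eq_of_forall_mem_iff hHf hh]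

/-- The coset of an element of `X + H` lies in `X + H`. [folklore] -/
private theorem coset_subset_add_of_mem {H : AddSubgroup G} {Hf X : Finset G}
    (hHf : ∀ g, g ∈ Hf ↔ g ∈ H) {β : G} (hβ : β ∈ X + Hf) : β +ᵥ Hf ⊆ X + Hf := by
  obtain ⟨b', hb', k, hk, rfl⟩ := mem_add.1 hβ
  intro y hy
  obtain ⟨k', hk', rfl⟩ := mem_vadd_finset.1 hy
  refine mem_add.2 ⟨b', hb', k + k', (hHf _).2 (H.add_mem ((hHf k).1 hk) ((hHf k').1 hk')), ?_⟩
  rw [vadd_eq_add, add_assoc]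

/-- **Proposition 2.1 (i) for a one-hole coset trace against two elements of one coset.**  If
`A₁ ⊆ α + H` misses exactly one element of its coset and `b ≠ b'` are elements of `B` in one `H`-coset,
then the whole coset `α + b + H` lies in `A₁ + B` ("Since `|A₁| = |H| − 1` and `|B_{b′_i}| > 1`, it
follows in view of Proposition 2.1 …", proof of Lemma 5.7). [cite: Grynkiewicz2009, Lemma 5.7 (proof)] -/
theorem coset_subset_add_of_pair {H : AddSubgroup G} {Hf A₁ B : Finset G}
    (hHf : ∀ g, g ∈ Hf ↔ g ∈ H) {α b b' : G} (hA₁ : A₁ ⊆ α +ᵥ Hf) (hcard : #A₁ + 1 = #Hf)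
    (hb : b ∈ B) (hb' : b' ∈ B) (hne : b' ≠ b) (hbb' : b' - b ∈ H) :
    (α + b) +ᵥ Hf ⊆ A₁ + B := by
  have hY : ({b, b'} : Finset G) ⊆ b +ᵥ Hf := by
    intro y hy
    rw [mem_insert, mem_singleton] at hy
    rcases hy with rfl | rfl
    · exact (mem_coset_iff hHf).2 (by rw [sub_self]; exact H.zero_mem)
    · exact (mem_coset_iff hHf).2 hbb'
  have h2 : #({b, b'} : Finset G) = 2 := card_pair hne.symm
  have := vadd_subset_add_of_card_lt hHf hA₁ hY (by rw [h2]; omega)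
  exact this.trans (add_subset_add_left (insert_subset hb (singleton_subset_iff.2 hb')))

/-- The `H`-hole of a one-hole coset trace: if `A₁ ⊆ α + H`, `α ∉ A₁`, `|A₁| = |H| − 1`, `b ∈ B`, and
`y ∈ α + b + H` is not in `A₁ + B`, then `y = α + b` (the coset `α + b + H` contains `A₁ + b`, which
misses only `α + b`). [cite: Grynkiewicz2009, Lemma 5.7 (proof)] -/
theorem eq_hole_of_notMem_add {H : AddSubgroup G} {Hf A₁ B : Finset G}
    (hHf : ∀ g, g ∈ Hf ↔ g ∈ H) {α b y : G} (hA₁ : A₁ ⊆ α +ᵥ Hf) (hαA₁ : α ∉ A₁)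
    (hcard : #A₁ + 1 = #Hf) (hb : b ∈ B) (hy : y ∈ (α + b) +ᵥ Hf) (hyAB : y ∉ A₁ + B) :
    y = α + b := by
  have hsub : b +ᵥ A₁ ⊆ (α + b) +ᵥ Hf := fun w hw => by
    obtain ⟨a, ha, rfl⟩ := mem_vadd_finset.1 hw
    have := (mem_coset_iff hHf).1 (hA₁ ha)
    refine (mem_coset_iff hHf).2 ?_
    have e : (b +ᵥ a) - (α + b) = a - α := by rw [vadd_eq_add]; abel
    rwa [e]
  have hone : #(((α + b) +ᵥ Hf) \ (b +ᵥ A₁)) = 1 := by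
    rw [card_sdiff_of_subset hsub, card_vadd_finset, card_vadd_finset]; omega
  obtain ⟨w, hw⟩ := card_eq_one.1 hone
  have hy' : y ∈ ((α + b) +ᵥ Hf) \ (b +ᵥ A₁) := by
    refine mem_sdiff.2 ⟨hy, fun hmem => hyAB ?_⟩
    obtain ⟨a, ha, rfl⟩ := mem_vadd_finset.1 hmem
    rw [vadd_eq_add, add_comm b a]; exact add_mem_add ha hb
  have hαb : α + b ∈ ((α + b) +ᵥ Hf) \ (b +ᵥ A₁) := by
    refine mem_sdiff.2 ⟨(mem_coset_iff hHf).2 (by rw [sub_self]; exact H.zero_mem), fun hmem => hαA₁ ?_⟩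
    obtain ⟨a, ha, hav⟩ := mem_vadd_finset.1 hmem
    rw [vadd_eq_add, add_comm b a] at hav
    rwa [← add_right_cancel hav]
  rw [hw, mem_singleton] at hy' hαb
  rw [hy', hαb]

omit [DecidableEq G] in
/-- **Coset walk.**  In a finite abelian group with `⟨d⟩ + K = G`: a property of elements that is
stable under `g ↦ g + d` and under `g ↦ g + k` (`k ∈ K`) and holds somewhere holds everywhere (the
step "since `φ_H(A₁) − φ_H(A₀)` generates `G/H` …" in Case 2 of the proof of Lemma 5.7, done in `G`
rather than in `G/H`). [cite: Grynkiewicz2009, Lemma 5.7 (proof, Case 2)] -/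
theorem forall_of_add_invariant [Finite G] {K : AddSubgroup G} {d : G}
    (htop : AddSubgroup.zmultiples d ⊔ K = ⊤) {P : G → Prop} (hd : ∀ g, P g → P (g + d))
    (hK : ∀ g k, k ∈ K → P g → P (g + k)) {g₀ : G} (h0 : P g₀) (g : G) : P g := by
  have hmem : g - g₀ ∈ AddSubgroup.zmultiples d ⊔ K := by rw [htop]; exact AddSubgroup.mem_top _
  obtain ⟨y, hy, k, hk, hyk⟩ := AddSubgroup.mem_sup.1 hmem
  -- `y = n • d` with `n : ℕ` (finite order)
  have hfin : IsOfFinAddOrder d := isOfFinAddOrder_of_finite d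
  have hy' : y ∈ AddSubmonoid.multiples d := by
    rw [← SetLike.mem_coe, hfin.multiples_eq_zmultiples]; exact hy
  obtain ⟨n, rfl⟩ := (AddSubmonoid.mem_multiples_iff _ _).1 hy'
  have hn : ∀ m : ℕ, P (g₀ + m • d) := by
    intro m
    induction m with
    | zero => simpa using h0
    | succ m ih => have := hd _ ih; rwa [add_assoc, ← succ_nsmul] at this
  have := hK _ k hk (hn n)
  have e : g₀ + n • d + k = g := by rw [add_assoc, hyk]; abel
  rwa [e] at this

/-- Subsets of two distinct `H`-cosets are disjoint. [folklore] -/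
private theorem disjoint_of_subset_coset {H : AddSubgroup G} {Hf X Y : Finset G}
    (hHf : ∀ g, g ∈ Hf ↔ g ∈ H) {x y : G} (hX : X ⊆ x +ᵥ Hf) (hY : Y ⊆ y +ᵥ Hf) (hxy : x - y ∉ H) :
    Disjoint X Y := by
  rw [disjoint_left]
  intro z hzX hzY
  apply hxy
  have e : x - y = (z - y) - (z - x) := by abel
  rw [e]; exact H.sub_mem ((mem_coset_iff hHf).1 (hY hzY)) ((mem_coset_iff hHf).1 (hX hzX))

/-- An element lies in its own coset. [folklore] -/
private theorem mem_coset_self {H : AddSubgroup G} {Hf : Finset G} (hHf : ∀ g, g ∈ Hf ↔ g ∈ H)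
    (c : G) : c ∈ c +ᵥ Hf :=
  (mem_coset_iff hHf).2 (by rw [sub_self]; exact H.zero_mem)

/-- Congruent elements have the same coset. [folklore] -/
private theorem coset_eq_of_sub_mem {H : AddSubgroup G} {Hf : Finset G} (hHf : ∀ g, g ∈ Hf ↔ g ∈ H)
    {x y : G} (h : x - y ∈ H) : x +ᵥ Hf = y +ᵥ Hf := by
  refine eq_of_subset_of_card_le (fun z hz => (mem_coset_iff hHf).2 ?_) (by rw [card_vadd_finset,
    card_vadd_finset])
  have e : z - y = (z - x) + (x - y) := by abel
  rw [e]; exact H.add_mem ((mem_coset_iff hHf).1 hz) h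

/-! ### The singletons `b₁, …, b_c` of an `H`-coset decomposition of `B` -/

/-- Membership in the finset `S` of "those elements of `B` that are the unique element from their `H`-coset
in `B`" (print p. 19), when `S` is realised as a `Finset.filter` with `H` carried as the finset `Hf`.
[cite: Grynkiewicz2009, Lemma 5.7 (proof)] -/
theorem mem_singletons_iff {B Hf : Finset G} {H : AddSubgroup G} (hHf : ∀ g, g ∈ Hf ↔ g ∈ H)
    {b : G} : b ∈ B.filter (fun b => ∀ b' ∈ B, b' - b ∈ Hf → b' = b) ↔
      b ∈ B ∧ ∀ b' ∈ B, b' - b ∈ H → b' = b := by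
  rw [mem_filter]
  refine and_congr_right fun _ => forall₂_congr fun b' _ => ?_
  rw [hHf]

/-- A non-singleton `b ∈ B ∖ S` completes its coset against a one-hole coset trace `A₁`:
`α + b + H ⊆ A₁ + B` ("Since `|A₁| = |H| − 1` and `|B_{b′_i}| > 1`, it follows in view of
Proposition 2.1 …"). [cite: Grynkiewicz2009, Lemma 5.7 (proof)] -/
theorem coset_subset_add_of_notMem_singletons {A₁ B Hf S : Finset G} {H : AddSubgroup G}
    (hHf : ∀ g, g ∈ Hf ↔ g ∈ H) (hS : ∀ b, b ∈ S ↔ b ∈ B ∧ ∀ b' ∈ B, b' - b ∈ H → b' = b)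
    {α b : G} (hA₁ : A₁ ⊆ α +ᵥ Hf) (hA₁card : #A₁ + 1 = #Hf) (hb : b ∈ B) (hbS : b ∉ S) :
    (α + b) +ᵥ Hf ⊆ A₁ + B := by
  rw [hS] at hbS
  push Not at hbS
  obtain ⟨b', hb', hbb', hne⟩ := hbS hb
  exact coset_subset_add_of_pair hHf hA₁ hA₁card hb hb' hne hbb'

/-- The coset count behind (35)/(36): `|B + H| = c|H| + |B′ + H|` where `S` (of size `c`) is the set
of singletons and `B′ = B ∖ S` ("`(l + c)|H|`" cosets met by `B`; the singletons occupy `c` full cosets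
of `B + H`, pairwise distinct and distinct from those of `B′`). [cite: Grynkiewicz2009, Lemma 5.7 (proof)] -/
theorem card_add_coset_eq_of_singletons {B Hf S : Finset G} {H : AddSubgroup G}
    (hHf : ∀ g, g ∈ Hf ↔ g ∈ H) (hS : ∀ b, b ∈ S ↔ b ∈ B ∧ ∀ b' ∈ B, b' - b ∈ H → b' = b) :
    #(B + Hf) = #S * #Hf + #((B \ S) + Hf) := by
  have hSB : S ⊆ B := fun b hb => ((hS b).1 hb).1
  have memS : ∀ {b}, b ∈ S ↔ b ∈ B ∧ ∀ b' ∈ B, b' - b ∈ H → b' = b := fun {b} => hS b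
  have hdisj : Disjoint (S + Hf) ((B \ S) + Hf) := by
    rw [disjoint_left]
    rintro y hy1 hy2
    obtain ⟨b, hb, k, hk, rfl⟩ := mem_add.1 hy1
    obtain ⟨b', hb', k', hk', he⟩ := mem_add.1 hy2
    have hbb' : b' - b ∈ H := by
      have e : b' - b = k - k' := by rw [sub_eq_sub_iff_add_eq_add, he, add_comm]
      rw [e]; exact H.sub_mem ((hHf k).1 hk) ((hHf k').1 hk')
    have := (memS.1 hb).2 b' (mem_sdiff.1 hb').1 hbb'
    rw [this] at hb'
    exact (mem_sdiff.1 hb').2 hb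
  have hBHf : B + Hf = (S + Hf) ∪ ((B \ S) + Hf) := by
    rw [← union_add, union_comm, sdiff_union_of_subset hSB]
  have hSHf : #(S + Hf) = #S * #Hf := by
    have heq : S + Hf = S.biUnion (fun b => b +ᵥ Hf) := by
      ext y; simp only [mem_add, mem_biUnion, mem_vadd_finset, vadd_eq_add]
    have hpd : ∀ x ∈ S, ∀ y ∈ S, x ≠ y → Disjoint (x +ᵥ Hf) (y +ᵥ Hf) := by
      intro b hb b' hb' hne
      refine disjoint_of_subset_coset hHf Subset.rfl Subset.rfl fun hbb' => hne ?_
      exact ((memS.1 hb).2 b' (hSB hb') (by have := H.neg_mem hbb'; rwa [neg_sub] at this)).symm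
    rw [heq, card_biUnion hpd]
    simp only [card_vadd_finset, sum_const, smul_eq_mul]
  rw [hBHf, card_union_of_disjoint hdisj, hSHf]

/-! ### The reduction: `d⊆(A, QP) = 1` forces the shape of Lemma 5.6 or a two-coset shape -/

/-- **The opening reduction of the proof of Lemma 5.7.**  If `A` is not quasi-periodic but `A ∪ {α}`
is (for some `α ∉ A`; i.e. `d⊆(A, QP) = 1`), then for the quasi-period `K ≠ 0` of `A ∪ {α}` (carried also
as a finset `Kf`): `α` lies in the periodic part, and `A = P ∪ ((α + K) ∖ {α}) ∪ A₀` with `P`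
`K`-periodic (possibly empty) and `A₀` inside one `K`-coset — "In view of Lemma 5.6, it follows the proof
is complete unless `A = A₁ ∪ A₀` with each `A_i` a subset of an `H`-coset and `|A₁| = |H| − 1`, for some
nontrivial subgroup `H`" (the case `P ≠ ∅` being Lemma 5.6's hypothesis).
[cite: Grynkiewicz2009, Lemma 5.7 (proof)] -/
theorem shape_of_insert_isQuasiPeriodic [Fintype G] {A : Finset G} {α : G} (hα : α ∉ A)
    (hqp : IsQuasiPeriodic (insert α A)) (hAqp : ¬ IsQuasiPeriodic A) :
    ∃ (K : AddSubgroup G) (Kf P A₀ : Finset G), K ≠ ⊥ ∧ (∀ g, g ∈ Kf ↔ g ∈ K) ∧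
      IsPeriodicWith K P ∧ (∀ x ∈ A₀, ∀ y ∈ A₀, x - y ∈ K) ∧ α ∉ A₀ ∧ Disjoint P (α +ᵥ Kf) ∧
      A = P ∪ (α +ᵥ Kf).erase α ∪ A₀ := by
  classical
  obtain ⟨K, P₁, P₀, hd, hne⟩ := hqp
  let Kf : Finset G := univ.filter (fun x => x ∈ K)
  have hKf : ∀ g, g ∈ Kf ↔ g ∈ K := fun g => by simp [Kf]
  -- `α` lies in the periodic part
  have hαP₁ : α ∈ P₁ := by
    by_contra hαP₁
    have hαP₀ : α ∈ P₀ := by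
      have : α ∈ P₁ ∪ P₀ := by rw [hd.union_eq]; exact mem_insert_self α A
      rcases mem_union.1 this with h | h
      · exact absurd h hαP₁
      · exact h
    apply hAqp
    refine ⟨K, P₁, P₀.erase α, ⟨hd.ne_bot, ?_, ?_, hd.periodic, fun x hx y hy =>
      hd.sub_mem x (mem_of_mem_erase hx) y (mem_of_mem_erase hy)⟩, hne⟩
    · exact hd.disjoint.mono_right (erase_subset α P₀)
    · rw [← erase_insert hα, ← hd.union_eq, erase_union_distrib, erase_eq_of_notMem hαP₁]
  have hcos : α +ᵥ Kf ⊆ P₁ := fun x hx => by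
    obtain ⟨k, hk, rfl⟩ := mem_vadd_finset.1 hx
    rw [vadd_eq_add, add_comm]
    exact hd.periodic.add_mem ((hKf k).1 hk) hαP₁
  have hαP₀ : α ∉ P₀ := fun h => disjoint_left.1 hd.disjoint hαP₁ h
  refine ⟨K, Kf, P₁ \ (α +ᵥ Kf), P₀, hd.ne_bot, hKf, ?_, hd.sub_mem, hαP₀, disjoint_sdiff_self_left, ?_⟩
  · intro k hk
    rw [vadd_finset_sdiff, hd.periodic k hk, isPeriodicWith_coset hKf α k hk]
  · have hA : A = (P₁ ∪ P₀).erase α := by rw [hd.union_eq, erase_insert hα]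
    have hαcos : α ∈ α +ᵥ Kf := (mem_coset_iff hKf).2 (by rw [sub_self]; exact K.zero_mem)
    rw [hA]
    ext x
    simp only [mem_erase, mem_union, mem_sdiff]
    constructor
    · rintro ⟨hxα, hx | hx⟩
      · by_cases hxc : x ∈ α +ᵥ Kf
        · exact Or.inl (Or.inr ⟨hxα, hxc⟩)
        · exact Or.inl (Or.inl ⟨hx, hxc⟩)
      · exact Or.inr hx
    · rintro ((⟨hx, hxc⟩ | ⟨hxα, hxc⟩) | hx)
      · exact ⟨fun h => hxc (by rw [h]; exact hαcos), Or.inl hx⟩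
      · exact ⟨hxα, Or.inl (hcos hxc)⟩
      · exact ⟨fun h => hαP₀ (by rw [← h]; exact hx), Or.inr hx⟩

/-! ### Lemma 5.6 applied through an `H`-periodic part that need not have maximal period `H` -/

/-- **Lemma 5.6 with a periodic part of not necessarily maximal period.**  If `A = P ∪ S₁ ∪ S₂` with `P`
nonempty and `H`-periodic (`H ≠ 0`), `S₁` inside one `H`-coset and `S₂` inside one `H`-coset, and the
remaining hypotheses of Lemma 5.6 hold, then both conclusions of Lemma 5.6 hold: `d⊆(C, QP) = 1` for the
six sets and (17).  (Pass to the maximal period `K = H(P) ≥ H` of `P`, as print does with "a nonempty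
periodic subset with maximal period `H`"; the `S_i` stay inside `K`-cosets.)
[cite: Grynkiewicz2009, Lemma 5.6] -/
theorem lemma56_of_periodic_union [Fintype G] {A B P S₁ S₂ : Finset G} {H : AddSubgroup G}
    (hA : A = P ∪ S₁ ∪ S₂) (hPne : P.Nonempty) (hH : H ≠ ⊥) (hP : IsPeriodicWith H P)
    (hS₁ : ∀ x ∈ S₁, ∀ y ∈ S₁, x - y ∈ H) (hS₂ : ∀ x ∈ S₂, ∀ y ∈ S₂, x - y ∈ H)
    (hA3 : 3 ≤ #A) (hB3 : 3 ≤ #B) (h0A : (0 : G) ∈ A) (h0B : (0 : G) ∈ B)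
    (hAB : #(A + B) = #A + #B)
    (hP3 : ∀ P : Finset G, A + B ⊆ P → P.addStab ≠ {0} → 3 ≤ #(P \ (A + B)))
    (hneA : IsNonExtendible A B) (hneB : IsNonExtendible B A)
    (hgen : AddSubgroup.closure (A : Set G) = ⊤) (hAqp : ¬ IsQuasiPeriodic A) :
    (∀ C ∈ ({A, B, A + B, Aᶜ, Bᶜ, (A + B)ᶜ} : Finset (Finset G)),
        subsetDist C {P | IsQuasiPeriodic P} = 1) ∧
      ∃ α β : G, #(insert α A + insert β B) + 1 = #(insert α A) + #(insert β B) := by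
  classical
  let K : AddSubgroup G := AddAction.stabilizer G P
  have hmemK : ∀ g, g ∈ K ↔ g +ᵥ P = P := fun g => AddAction.mem_stabilizer_iff
  have hPK : ∀ g, g ∈ P.addStab ↔ g ∈ K := fun g => by rw [mem_addStab hPne, hmemK]
  have hHK : H ≤ K := fun h hh => (hmemK h).2 (hP h hh)
  have hK : K ≠ ⊥ := fun h => hH (le_bot_iff.1 (h ▸ hHK))
  have center : ∀ {S : Finset G}, (∀ x ∈ S, ∀ y ∈ S, x - y ∈ H) → ∃ s, ∀ x ∈ S, x - s ∈ K := by
    intro S hS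
    rcases S.eq_empty_or_nonempty with rfl | ⟨s, hs⟩
    · exact ⟨0, fun x hx => by simp at hx⟩
    · exact ⟨s, fun x hx => hHK (hS x hx s hs)⟩
  obtain ⟨s₁, hs₁⟩ := center hS₁
  obtain ⟨s₂, hs₂⟩ := center hS₂
  refine ⟨fun C hC => ?_, ?_⟩
  · exact (subsetDist_eq_one_of_nearly_periodic hA hPne hK hPK hs₁ hs₂ hA3 hB3 h0A h0B hAB hP3 hneA
      hneB hgen hAqp C hC).2
  · exact seventeen_of_nearly_periodic hA hPne hK hPK hs₁ hs₂ hA3 hB3 h0A h0B hAB hP3 hneA hneB hgen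
      hAqp

/-- The six sets of the pair `(B, A)` are those of `(A, B)`. [folklore] -/
private theorem mem_six_comm [Fintype G] {A B C : Finset G} :
    C ∈ ({B, A, B + A, Bᶜ, Aᶜ, (B + A)ᶜ} : Finset (Finset G)) ↔
      C ∈ ({A, B, A + B, Aᶜ, Bᶜ, (A + B)ᶜ} : Finset (Finset G)) := by
  simp only [mem_insert, mem_singleton, add_comm B A]
  tauto

/-! ### Lemma 5.7, Case 1: display (35) and its consequences -/

/-- **Lemma 5.7, Case 1 — display (35).**  Setting (print p. 19): `A = A₁ ∪ A₀` with `A₁ ⊆ α + H`,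
`|A₁| = |H| − 1` (hole `α`), `A₀ ⊆ a₀ + H` another coset, `|H| ≥ 3`, `|B| ≥ 3`, `|A + B| ≤ |A| + |B|`,
`A` non-extendible w.r.t. `B`; "Let `b₁, …, b_c` be those elements of `B` that are the unique element from
their `H`-coset in `B`" (the finset `S`, `c = |S|`), "and let `B′ = B_{b′₁} ∪ … ∪ B_{b′_l}` be an `H`-coset
decomposition of the remaining elements of `B`" (`B′ = B ∖ S`), `ρ′ = |B′ + H| − |B′|` the number of
`H`-holes in `B′`.  In Case 1 ("`|φ_H(A) + φ_H(B)| ≥ |φ_H(B)| + 1`"; here: some coset `a₀ + b + H`,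
`b ∈ B`, is none of the cosets `α + b′ + H`, `b′ ∈ B`): "`|A + B| ≥ |A₁ + B| + |A₀| ≥ (l + c)|H| − c + |A₀|`",
whence **(35)** "`ρ′ + (c − 1)(|H| − 2) − 1 ≤ 0`"; "`c ≥ 1`, since otherwise adding the `H`-hole contained
in `A₁` will … contradict the non-extendibility of `A`" (indeed the witness `b₁` of non-extendibility at `α`
lies in `S`); and since `|H| ≥ 3`, (35) leaves only `ρ′ = 0, c ≤ 2` or `ρ′ = c = 1` ("If `ρ′ > 1`, then (35)
and `|H| ≥ 3` imply `c ≤ 0` … `ρ′ = 1`, whence (35) and `|H| ≥ 3` imply `c = 1`"; "`c ≥ 3`, whence (35)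
implies `2|H| ≤ 5`"). [cite: Grynkiewicz2009, Lemma 5.7 (proof, Case 1, display (35))] -/
theorem case_one_count {A A₁ A₀ B Hf S : Finset G} {H : AddSubgroup G} {α a₀ : G}
    (hHf : ∀ g, g ∈ Hf ↔ g ∈ H) (hHf3 : 3 ≤ #Hf)
    (hA : A = A₁ ∪ A₀) (hA₁ : A₁ ⊆ α +ᵥ Hf) (hαA₁ : α ∉ A₁) (hA₁card : #A₁ + 1 = #Hf)
    (hA₀ : A₀ ⊆ a₀ +ᵥ Hf) (h10 : α - a₀ ∉ H)
    (hAB : #(A + B) ≤ #A + #B) (hneA : IsNonExtendible A B)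
    (hcase : ∃ b ∈ B, ∀ b' ∈ B, (a₀ + b) - (α + b') ∉ H)
    (hS : ∀ b, b ∈ S ↔ b ∈ B ∧ ∀ b' ∈ B, b' - b ∈ H → b' = b) :
    ∃ b₁ ∈ S, α + b₁ ∉ A + B ∧
      ((#((B \ S) + Hf) = #(B \ S) ∧ #S ≤ 2) ∨ (#((B \ S) + Hf) = #(B \ S) + 1 ∧ #S = 1)) := by
  have h0Hf : (0 : G) ∈ Hf := (hHf 0).2 H.zero_mem
  have hA₁A : A₁ ⊆ A := by rw [hA]; exact subset_union_left
  have hA₀A : A₀ ⊆ A := by rw [hA]; exact subset_union_right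
  -- `α ∉ A`; `A₁`, `A₀` are disjoint
  have hαA : α ∉ A := by
    rw [hA, mem_union, not_or]
    exact ⟨hαA₁, fun h => h10 ((mem_coset_iff hHf).1 (hA₀ h))⟩
  have hd10 : Disjoint A₁ A₀ := by
    rw [disjoint_left]; intro x hx1 hx0
    apply h10
    have e : α - a₀ = (x - a₀) - (x - α) := by abel
    rw [e]; exact H.sub_mem ((mem_coset_iff hHf).1 (hA₀ hx0)) ((mem_coset_iff hHf).1 (hA₁ hx1))
  have hcardA : #A = #A₁ + #A₀ := by rw [hA, card_union_of_disjoint hd10]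
  -- the singletons `S = {b₁, …, b_c}` and the rest `B' = B ∖ S`
  obtain ⟨B', hB'⟩ : ∃ B' : Finset G, B' = B \ S := ⟨_, rfl⟩
  rw [← hB']
  have hSB : S ⊆ B := fun b hb => ((hS b).1 hb).1
  have hBdec : B = B' ∪ S := by rw [hB']; exact (sdiff_union_of_subset hSB).symm
  have memB' : ∀ {b}, b ∈ B' ↔ b ∈ B ∧ b ∉ S := fun {b} => by rw [hB', mem_sdiff]
  have hdisjB'S : Disjoint B' S := by rw [hB']; exact disjoint_sdiff_self_left
  have hcardB : #B = #B' + #S := by rw [hBdec, card_union_of_disjoint hdisjB'S]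
  have memS : ∀ {b}, b ∈ S ↔ b ∈ B ∧ ∀ b' ∈ B, b' - b ∈ H → b' = b := fun {b} => hS b
  -- a non-singleton `b` gives the full coset `α + b + H ⊆ A₁ + B`
  have hfull : ∀ {b : G}, b ∈ B → b ∉ S → (α + b) +ᵥ Hf ⊆ A₁ + B := fun hb hbS =>
    coset_subset_add_of_notMem_singletons hHf hS hA₁ hA₁card hb hbS
  -- `c ≥ 1`: the witness of non-extendibility at the hole `α` is a singleton
  obtain ⟨b₁, hb₁B, hb₁⟩ := isNonExtendible_iff.1 hneA α hαA
  have hb₁S : b₁ ∈ S := by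
    by_contra h
    exact hb₁ (add_subset_add_right hA₁A (hfull hb₁B h
      ((mem_coset_iff hHf).2 (by rw [sub_self]; exact H.zero_mem))))
  -- `A₁ + B ⊆ α + (B + H)`, missing at most `c` of its elements: `|A₁ + B| ≥ (l + c)|H| − c`
  have hU₁ : A₁ + B ⊆ α +ᵥ (B + Hf) := by
    intro y hy
    obtain ⟨a, ha, b, hb, rfl⟩ := mem_add.1 hy
    obtain ⟨k, hk, rfl⟩ := mem_vadd_finset.1 (hA₁ ha)
    exact mem_vadd_finset.2 ⟨b + k, add_mem_add hb hk, by rw [vadd_eq_add, vadd_eq_add]; abel⟩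
  have hU₂ : (α +ᵥ (B + Hf)) \ (A₁ + B) ⊆ S.image (fun b => α + b) := by
    intro y hy
    obtain ⟨hyU, hyAB⟩ := mem_sdiff.1 hy
    obtain ⟨z, hz, rfl⟩ := mem_vadd_finset.1 hyU
    obtain ⟨b, hb, k, hk, rfl⟩ := mem_add.1 hz
    have hycos : α +ᵥ (b + k) ∈ (α + b) +ᵥ Hf :=
      (mem_coset_iff hHf).2 (by
        rw [vadd_eq_add, show α + (b + k) - (α + b) = k by abel]; exact (hHf k).1 hk)
    have hbS : b ∈ S := by
      by_contra h
      exact hyAB (hfull hb h hycos)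
    rw [eq_hole_of_notMem_add hHf hA₁ hαA₁ hA₁card hb hycos hyAB]
    exact mem_image_of_mem _ hbS
  have hcount₁ : #(B + Hf) ≤ #(A₁ + B) + #S := by
    have h1 := card_sdiff_add_card_eq_card hU₁
    have h2 := (card_le_card hU₂).trans card_image_le
    rw [card_vadd_finset] at h1
    omega
  -- the extra coset `A₀ + b* + H`: `|A + B| ≥ |A₁ + B| + |A₀|`
  obtain ⟨bs, hbsB, hbs⟩ := hcase
  have hcount₂ : #(A₁ + B) + #A₀ ≤ #(A + B) := by
    have hsub : (A₁ + B) ∪ (bs +ᵥ A₀) ⊆ A + B := union_subset (add_subset_add_right hA₁A)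
      (fun y hy => by
        obtain ⟨a, ha, rfl⟩ := mem_vadd_finset.1 hy
        rw [vadd_eq_add, add_comm bs a]; exact add_mem_add (hA₀A ha) hbsB)
    have hdisj : Disjoint (A₁ + B) (bs +ᵥ A₀) := by
      rw [disjoint_right]
      intro y hy hyAB
      obtain ⟨a, ha, rfl⟩ := mem_vadd_finset.1 hy
      obtain ⟨a', ha', b', hb', he⟩ := mem_add.1 hyAB
      apply hbs b' hb'
      have e : a₀ + bs - (α + b') = (a' - α) - (a - a₀) - (a' + b' - (bs +ᵥ a)) := by
        rw [vadd_eq_add]; abel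
      rw [e, he, sub_self, sub_zero]
      exact H.sub_mem ((mem_coset_iff hHf).1 (hA₁ ha')) ((mem_coset_iff hHf).1 (hA₀ ha))
    have := card_le_card hsub
    rw [card_union_of_disjoint hdisj, card_vadd_finset] at this
    exact this
  -- display (35), additive form: `|B + H| ≤ |H| − 1 + |B| + c`
  have h35 : #(B + Hf) + 1 ≤ #Hf + #B + #S := by omega
  -- `B + H = (S + H) ⊔ (B' + H)` and `|S + H| = c|H|`
  have hcardBHf : #(B + Hf) = #S * #Hf + #(B' + Hf) := by
    rw [hB']; exact card_add_coset_eq_of_singletons hHf hS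
  -- numeric form of (35): `ρ' + c|H| ≤ |H| + 2c − 1`, and the case analysis
  have hρ : #B' ≤ #(B' + Hf) := card_le_card (subset_add_left B' h0Hf)
  rw [hcardBHf, hcardB] at h35
  refine ⟨b₁, hb₁S, hb₁, ?_⟩
  have hc1 : 1 ≤ #S := card_pos.2 ⟨b₁, hb₁S⟩
  -- "`c ≥ 3` … implies `2|H| ≤ 5`": so `c ≤ 2`
  have hc2 : #S ≤ 2 := by
    by_contra hlt
    have h1 : 3 * #Hf ≤ #S * #Hf := Nat.mul_le_mul_right _ (by omega)
    have h2 : #S * 3 ≤ #S * #Hf := Nat.mul_le_mul_left _ hHf3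
    omega
  rcases (by omega : #S = 1 ∨ #S = 2) with h | h
  · rw [h, one_mul] at h35
    omega
  · rw [h] at h35
    omega

/-- **Lemma 5.7, Case 1, the sub-case `ρ′ = 0` of (35):** then `c ≤ 2`, `B′ ≠ ∅` is `H`-periodic, and
`B = B′ ∪ {b₁} (∪ {b₂})` — "Suppose `ρ′ = 0`. If `B′` is empty, then `|B| ≥ 3` implies `c ≥ 3`;
otherwise, the cases `c ≤ 2` are covered by Lemma 5.6" (i.e. `B` has the shape of Lemma 5.6).
[cite: Grynkiewicz2009, Lemma 5.7 (proof, Case 1)] -/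
theorem case_one_shape_of_rho_zero {B Hf S : Finset G} {H : AddSubgroup G} {b₁ : G}
    (hHf : ∀ g, g ∈ Hf ↔ g ∈ H) (hS : ∀ b, b ∈ S ↔ b ∈ B ∧ ∀ b' ∈ B, b' - b ∈ H → b' = b)
    (hb₁S : b₁ ∈ S) (hB3 : 3 ≤ #B) (hρ0 : #((B \ S) + Hf) = #(B \ S)) (hc2 : #S ≤ 2) :
    ∃ (P S₁ S₂ : Finset G), B = P ∪ S₁ ∪ S₂ ∧ P.Nonempty ∧ IsPeriodicWith H P ∧
      (∀ x ∈ S₁, ∀ y ∈ S₁, x - y ∈ H) ∧ (∀ x ∈ S₂, ∀ y ∈ S₂, x - y ∈ H) := by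
  have h0Hf : (0 : G) ∈ Hf := (hHf 0).2 H.zero_mem
  have hSB : S ⊆ B := fun b hb => ((hS b).1 hb).1
  have hBdec : B = B \ S ∪ S := (sdiff_union_of_subset hSB).symm
  have hcardB : #B = #(B \ S) + #S := by rw [← card_union_of_disjoint disjoint_sdiff_self_left, ← hBdec]
  have hB'per : IsPeriodicWith H (B \ S) := by
    have heq : B \ S = B \ S + Hf := eq_of_subset_of_card_le (subset_add_left _ h0Hf) (le_of_eq hρ0)
    exact (isPeriodicWith_iff_add_eq hHf).2 heq.symm
  have hB'ne : (B \ S).Nonempty := by rw [← card_pos]; omega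
  refine ⟨B \ S, {b₁}, S.erase b₁, ?_, hB'ne, hB'per, ?_, ?_⟩
  · rw [union_assoc, ← insert_eq, insert_erase hb₁S]; exact hBdec
  · intro x hx y hy; rw [mem_singleton] at hx hy; rw [hx, hy, sub_self]; exact H.zero_mem
  · intro x hx y hy
    have : #(S.erase b₁) ≤ 1 := by rw [card_erase_of_mem hb₁S]; omega
    rw [card_le_one.1 this x hx y hy, sub_self]; exact H.zero_mem

/-- **Lemma 5.7, Case 1, the sub-case `ρ′ = c = 1` of (35):** `S = {b₁}` and `B′` has a single `H`-hole
`β`; with `T = B′ ∩ (β + H)` (a coset trace with exactly the hole `β`) and `B″ = B′ ∖ (β + H)`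
(`H`-periodic): either `B″ ≠ ∅` ("if `|φ_H(B)| > 2`, then the proof is complete in view of `ρ′ = 1` and
Lemma 5.6": `B = B″ ∪ T ∪ {b₁}` has the shape of Lemma 5.6) or `B″ = ∅` ("Otherwise `ρ′ = c = 1` implies
that `B = B₁ ∪ B₀` with both `B_i` nonempty subsets of disjoint `H`-cosets, `|B₁| = |H| − 1`, and
`|B₀| = 1`": `B = T ∪ {b₁}`, `b₁ ∉ β + H`). [cite: Grynkiewicz2009, Lemma 5.7 (proof, Case 1)] -/
theorem case_one_shape_of_rho_one {B Hf S : Finset G} {H : AddSubgroup G} {b₁ : G}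
    (hHf : ∀ g, g ∈ Hf ↔ g ∈ H) (hHf3 : 3 ≤ #Hf)
    (hS : ∀ b, b ∈ S ↔ b ∈ B ∧ ∀ b' ∈ B, b' - b ∈ H → b' = b)
    (hb₁S : b₁ ∈ S) (hρ1 : #((B \ S) + Hf) = #(B \ S) + 1) (hc1 : #S = 1) :
    (∃ (P S₁ S₂ : Finset G), B = P ∪ S₁ ∪ S₂ ∧ P.Nonempty ∧ IsPeriodicWith H P ∧
        (∀ x ∈ S₁, ∀ y ∈ S₁, x - y ∈ H) ∧ (∀ x ∈ S₂, ∀ y ∈ S₂, x - y ∈ H)) ∨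
      ∃ (T : Finset G) (t b : G), B = T ∪ {b} ∧ T ⊆ t +ᵥ Hf ∧ t ∉ T ∧ #T + 1 = #Hf ∧
        b - t ∉ H := by
  have h0Hf : (0 : G) ∈ Hf := (hHf 0).2 H.zero_mem
  have hSB : S ⊆ B := fun b hb => ((hS b).1 hb).1
  obtain ⟨B', hB'⟩ : ∃ B' : Finset G, B' = B \ S := ⟨_, rfl⟩
  rw [← hB'] at hρ1
  have hBdec : B = B' ∪ S := by rw [hB']; exact (sdiff_union_of_subset hSB).symm
  have memB' : ∀ {b}, b ∈ B' ↔ b ∈ B ∧ b ∉ S := fun {b} => by rw [hB', mem_sdiff]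
  have memS : ∀ {b}, b ∈ S ↔ b ∈ B ∧ ∀ b' ∈ B, b' - b ∈ H → b' = b := fun {b} => hS b
  have hSeq : S = {b₁} :=
    (eq_of_subset_of_card_le (singleton_subset_iff.2 hb₁S) (by rw [card_singleton]; omega)).symm
  -- the unique hole `β` of `B'`
  obtain ⟨β, hβ⟩ : ∃ β, (B' + Hf) \ B' = {β} := card_eq_one.1 (by
    rw [card_sdiff_of_subset (subset_add_left B' h0Hf)]; omega)
  have hβmem : β ∈ (B' + Hf) \ B' := by rw [hβ]; exact mem_singleton_self β
  obtain ⟨hβBH, hβB'⟩ := mem_sdiff.1 hβmem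
  have hβcos : β +ᵥ Hf ⊆ B' + Hf := coset_subset_add_of_mem hHf hβBH
  obtain ⟨T, hT⟩ : ∃ T : Finset G, T = B' ∩ (β +ᵥ Hf) := ⟨_, rfl⟩
  obtain ⟨B'', hB''⟩ : ∃ B'' : Finset G, B'' = B' \ (β +ᵥ Hf) := ⟨_, rfl⟩
  have memT : ∀ {x}, x ∈ T ↔ x ∈ B' ∧ x ∈ β +ᵥ Hf := fun {x} => by rw [hT, mem_inter]
  have hTcos : T ⊆ β +ᵥ Hf := fun x hx => (memT.1 hx).2
  have hβT : β ∉ T := fun h => hβB' (memT.1 h).1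
  have hβself : β ∈ β +ᵥ Hf := mem_coset_self hHf β
  have hTins : insert β T = β +ᵥ Hf := by
    refine Subset.antisymm (insert_subset hβself hTcos) fun y hy => ?_
    by_cases hyβ : y = β
    · rw [hyβ]; exact mem_insert_self β T
    · refine mem_insert_of_mem (memT.2 ⟨?_, hy⟩)
      by_contra hyB'
      have : y ∈ (B' + Hf) \ B' := mem_sdiff.2 ⟨hβcos hy, hyB'⟩
      rw [hβ, mem_singleton] at this
      exact hyβ this
  have hTcard : #T + 1 = #Hf := by
    rw [← card_vadd_finset β Hf, ← hTins, card_insert_of_notMem hβT]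
  have hB'dec : B' = B'' ∪ T := by rw [hB'', hT, sdiff_union_inter]
  have hB''per : IsPeriodicWith H B'' := by
    have hB''eq : B'' = (B' + Hf) \ (β +ᵥ Hf) := by
      ext x
      rw [hB'', mem_sdiff, mem_sdiff]
      constructor
      · rintro ⟨hx, hxβ⟩; exact ⟨subset_add_left B' h0Hf hx, hxβ⟩
      · rintro ⟨hx, hxβ⟩
        refine ⟨?_, hxβ⟩
        by_contra hxB'
        have : x ∈ (B' + Hf) \ B' := mem_sdiff.2 ⟨hx, hxB'⟩
        rw [hβ, mem_singleton] at this
        apply hxβ; rw [this]; exact hβself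
    rw [hB''eq]
    intro k hk
    rw [vadd_finset_sdiff, isPeriodicWith_add_of_forall_mem_iff hHf B' k hk,
      isPeriodicWith_coset hHf β k hk]
  rcases B''.eq_empty_or_nonempty with hB''e | hB''ne
  · -- `B = T ∪ {b₁}` with `|T| = |H| − 1`: the symmetric two-coset shape
    right
    refine ⟨T, β, b₁, ?_, hTcos, hβT, hTcard, fun h => ?_⟩
    · rw [hBdec, hB'dec, hB''e, empty_union, hSeq]
    · -- `b₁ − β ∈ H` would put `T` inside the trace `{b₁}` of the singleton `b₁`
      have hTsub : T ⊆ {b₁} := fun x hx => by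
        have hxB' : x ∈ B' := (memT.1 hx).1
        have hxβ : x - β ∈ H := (mem_coset_iff hHf).1 (memT.1 hx).2
        have hxb₁ : x - b₁ ∈ H := by
          have e : x - b₁ = (x - β) - (b₁ - β) := by abel
          rw [e]; exact H.sub_mem hxβ h
        exact mem_singleton.2 ((memS.1 hb₁S).2 x (memB'.1 hxB').1 hxb₁)
      have := card_le_card hTsub
      rw [card_singleton] at this
      omega
  · -- `B = B'' ∪ T ∪ {b₁}` with `B'' ≠ ∅` `H`-periodic: the shape of Lemma 5.6
    left
    refine ⟨B'', T, {b₁}, ?_, hB''ne, hB''per, ?_, ?_⟩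
    · rw [hBdec, hB'dec, hSeq]
    · intro x hx y hy
      have := H.sub_mem ((mem_coset_iff hHf).1 (hTcos hx)) ((mem_coset_iff hHf).1 (hTcos hy))
      rwa [sub_sub_sub_cancel_right] at this
    · intro x hx y hy; rw [mem_singleton] at hx hy; rw [hx, hy, sub_self]; exact H.zero_mem

/-- **Lemma 5.7, Case 1 — the consequences of (35)**, assembled from `case_one_count`,
`case_one_shape_of_rho_zero`, `case_one_shape_of_rho_one`: in the setting of Case 1, either `B` has the
shape of Lemma 5.6 (an `H`-periodic `P ≠ ∅` plus two pieces inside `H`-cosets, possibly empty) — the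
printed "covered by Lemma 5.6" exits — or "`B = B₁ ∪ B₀` with both `B_i` nonempty subsets of disjoint
`H`-cosets, `|B₁| = |H| − 1, and `|B₀| = 1`" (here `B = T ∪ {b}`, `T` a one-hole coset trace with hole
`t`, `b − t ∉ H`); in both cases together with the singleton `b₁ ∈ B` whose `H`-coset meets `B` only in
`b₁` and with `α + b₁ ∉ A + B`. [cite: Grynkiewicz2009, Lemma 5.7 (proof, Case 1)] -/
theorem case_one_core {A A₁ A₀ B Hf : Finset G} {H : AddSubgroup G} {α a₀ : G}
    (hHf : ∀ g, g ∈ Hf ↔ g ∈ H) (hHf3 : 3 ≤ #Hf)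
    (hA : A = A₁ ∪ A₀) (hA₁ : A₁ ⊆ α +ᵥ Hf) (hαA₁ : α ∉ A₁) (hA₁card : #A₁ + 1 = #Hf)
    (hA₀ : A₀ ⊆ a₀ +ᵥ Hf) (h10 : α - a₀ ∉ H)
    (hB3 : 3 ≤ #B) (hAB : #(A + B) ≤ #A + #B) (hneA : IsNonExtendible A B)
    (hcase : ∃ b ∈ B, ∀ b' ∈ B, (a₀ + b) - (α + b') ∉ H) :
    (∃ (P S₁ S₂ : Finset G), B = P ∪ S₁ ∪ S₂ ∧ P.Nonempty ∧ IsPeriodicWith H P ∧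
        (∀ x ∈ S₁, ∀ y ∈ S₁, x - y ∈ H) ∧ (∀ x ∈ S₂, ∀ y ∈ S₂, x - y ∈ H)) ∨
      ∃ (T : Finset G) (t b : G), B = T ∪ {b} ∧ T ⊆ t +ᵥ Hf ∧ t ∉ T ∧ #T + 1 = #Hf ∧
        b - t ∉ H := by
  have hS : ∀ b, b ∈ B.filter (fun b => ∀ b' ∈ B, b' - b ∈ Hf → b' = b) ↔
      b ∈ B ∧ ∀ b' ∈ B, b' - b ∈ H → b' = b := fun b => by
    rw [mem_filter]
    refine and_congr_right fun _ => forall₂_congr fun b' _ => ?_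
    rw [hHf]
  obtain ⟨b₁, hb₁S, -, hout⟩ := case_one_count hHf hHf3 hA hA₁ hαA₁ hA₁card hA₀ h10 hAB hneA hcase hS
  rcases hout with ⟨hρ0, hc2⟩ | ⟨hρ1, hc1⟩
  · exact Or.inl (case_one_shape_of_rho_zero hHf hS hb₁S hB3 hρ0 hc2)
  · exact case_one_shape_of_rho_one hHf hHf3 hS hb₁S hρ1 hc1

/-! ### Lemma 5.7, Case 1: the final two-coset configuration -/

/-- **Lemma 5.7, Case 1, the configuration `A = A₁ ∪ A₀`, `B = B₁ ∪ B₀` with `|A₁| = |B₁| = |H| − 1`,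
`|B₀| = 1`.**  Print argues "the hypotheses of the lemma and the case are satisfied by interchanging the
roles of `A` and `B`, whence `|A₀| = 1` follows by the above argument as well … In view of Proposition 2.1
and `|H| ≥ 3`, it follows that `|A₁ + B₁| = |H|` and `A₀ + B₁ = A₁ + B₀`, since otherwise
`|A + B| ≥ 2|H| + 1 > |A| + |B|`".  Here both facts are obtained at once by counting the four blocks
`A₁ + B₁` (a full coset, Proposition 2.1 (i)), `A₁ + B₀`, `A₀ + B₁`, `A₀ + B₀` of `A + B` against
`|A + B| ≤ |A| + |B|` and the Case-1 hypothesis (three cosets): the cosets of `A₁ + B₀` and `A₀ + B₁`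
coincide, those of `A₁ + B₁` and `A₀ + B₀` do not, `|A₀| = 1`, `A₀ + B₁ = A₁ + B₀` and
`A₁ + B₁ = α + t + H` (`α`, `t` the holes of `A₁`, `B₁ = T`; `B₀ = {b₁}`).
[cite: Grynkiewicz2009, Lemma 5.7 (proof, Case 1)] -/
theorem case_one_two_by_two {A A₁ A₀ B T Hf : Finset G} {H : AddSubgroup G} {α a₀ t b₁ : G}
    (hHf : ∀ g, g ∈ Hf ↔ g ∈ H) (hHf3 : 3 ≤ #Hf)
    (hA : A = A₁ ∪ A₀) (hA₁ : A₁ ⊆ α +ᵥ Hf) (hA₁card : #A₁ + 1 = #Hf)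
    (hA₀ : A₀ ⊆ a₀ +ᵥ Hf) (hA₀ne : A₀.Nonempty) (hA₀card : #A₀ + 1 ≤ #Hf) (h10 : α - a₀ ∉ H)
    (hB : B = T ∪ {b₁}) (hT : T ⊆ t +ᵥ Hf) (hTcard : #T + 1 = #Hf) (hb₁t : b₁ - t ∉ H)
    (hAB : #(A + B) ≤ #A + #B)
    (hcase : ∃ b ∈ B, ∀ b' ∈ B, (a₀ + b) - (α + b') ∉ H) :
    ∃ x₀ : G, A₀ = {x₀} ∧ (α + b₁) - (a₀ + t) ∈ H ∧ (α + t) - (a₀ + b₁) ∉ H ∧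
      A₀ + T = A₁ + {b₁} ∧ A₁ + T = (α + t) +ᵥ Hf := by
  have hd10 : Disjoint A₁ A₀ := disjoint_of_subset_coset hHf hA₁ hA₀ h10
  have hcardA : #A = #A₁ + #A₀ := by rw [hA, card_union_of_disjoint hd10]
  have hb₁T : b₁ ∉ T := fun h => hb₁t ((mem_coset_iff hHf).1 (hT h))
  have hcardB : #B = #T + 1 := by
    rw [hB, card_union_of_disjoint (disjoint_singleton_right.2 hb₁T), card_singleton]
  have hTne : T.Nonempty := by rw [← card_pos]; omega
  obtain ⟨x₀, hx₀⟩ := hA₀ne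
  have hA₀pos : 0 < #A₀ := card_pos.2 ⟨x₀, hx₀⟩
  -- the four blocks
  have hABdec : A + B = (A₁ + T ∪ (A₁ + {b₁})) ∪ (A₀ + T ∪ (A₀ + {b₁})) := by
    rw [hA, hB, union_add, add_union, add_union]
  have hsing : ∀ {c : G}, ({c} : Finset G) ⊆ c +ᵥ Hf := fun {c} =>
    singleton_subset_iff.2 (mem_coset_self hHf c)
  have hX₁cos : A₁ + T ⊆ (α + t) +ᵥ Hf := add_subset_coset hHf hA₁ hT
  have hX₁eq : A₁ + T = (α + t) +ᵥ Hf :=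
    Subset.antisymm hX₁cos (vadd_subset_add_of_card_lt hHf hA₁ hT (by omega))
  have hX₂cos : A₁ + {b₁} ⊆ (α + b₁) +ᵥ Hf := add_subset_coset hHf hA₁ hsing
  have hX₃cos : A₀ + T ⊆ (a₀ + t) +ᵥ Hf := add_subset_coset hHf hA₀ hT
  have hX₄cos : A₀ + {b₁} ⊆ (a₀ + b₁) +ᵥ Hf := add_subset_coset hHf hA₀ hsing
  have hX₁card : #(A₁ + T) = #Hf := by rw [hX₁eq, card_vadd_finset]
  have hX₂card : #(A₁ + {b₁}) = #A₁ := card_add_singleton A₁ b₁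
  have hX₄card : #(A₀ + {b₁}) = #A₀ := card_add_singleton A₀ b₁
  have hX₃ge : #T ≤ #(A₀ + T) := by
    have : x₀ +ᵥ T ⊆ A₀ + T := fun y hy => by
      obtain ⟨z, hz, rfl⟩ := mem_vadd_finset.1 hy
      exact add_mem_add hx₀ hz
    have := card_le_card this; rwa [card_vadd_finset] at this
  -- `|A₀ + T| > |A₀|`
  have hX₃gt : #A₀ < #(A₀ + T) := by
    by_cases h : #Hf < #A₀ + #T
    · have := card_le_card (vadd_subset_add_of_card_lt hHf hA₀ hT h)
      rw [card_vadd_finset] at this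
      omega
    · omega
  -- class separations that always hold
  have hne12 : (α + t) - (α + b₁) ∉ H := fun h => hb₁t (by
    have e : b₁ - t = -((α + t) - (α + b₁)) := by abel
    rw [e]; exact H.neg_mem h)
  have hne13 : (α + t) - (a₀ + t) ∉ H := fun h => h10 (by
    have e : α - a₀ = (α + t) - (a₀ + t) := by abel
    rwa [e])
  have hne24 : (α + b₁) - (a₀ + b₁) ∉ H := fun h => h10 (by
    have e : α - a₀ = (α + b₁) - (a₀ + b₁) := by abel
    rwa [e])
  have hne34 : (a₀ + t) - (a₀ + b₁) ∉ H := fun h => hb₁t (by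
    have e : b₁ - t = -((a₀ + t) - (a₀ + b₁)) := by abel
    rw [e]; exact H.neg_mem h)
  have hsub₁ : A₁ + T ⊆ A + B := by
    rw [hABdec]; exact subset_union_left.trans subset_union_left
  have hsub₂ : A₁ + {b₁} ⊆ A + B := by
    rw [hABdec]; exact subset_union_right.trans subset_union_left
  have hsub₃ : A₀ + T ⊆ A + B := by
    rw [hABdec]; exact subset_union_left.trans subset_union_right
  -- the cosets of `A₁ + b₁` and `A₀ + T` coincide (else three blocks already exceed `|A| + |B|`)
  have hP₁ : (α + b₁) - (a₀ + t) ∈ H := by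
    by_contra hP₁
    have hd12 : Disjoint (A₁ + T) (A₁ + {b₁}) := disjoint_of_subset_coset hHf hX₁cos hX₂cos hne12
    have hd13 : Disjoint (A₁ + T) (A₀ + T) := disjoint_of_subset_coset hHf hX₁cos hX₃cos hne13
    have hd23 : Disjoint (A₁ + {b₁}) (A₀ + T) := disjoint_of_subset_coset hHf hX₂cos hX₃cos hP₁
    have hsub : (A₁ + T) ∪ (A₁ + {b₁}) ∪ (A₀ + T) ⊆ A + B :=
      union_subset (union_subset hsub₁ hsub₂) hsub₃
    have := card_le_card hsub
    rw [card_union_of_disjoint (disjoint_union_left.2 ⟨hd13, hd23⟩), card_union_of_disjoint hd12,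
      hX₁card, hX₂card] at this
    omega
  -- the cosets of `A₁ + T` and `A₀ + b₁` differ (else only two cosets, contradicting Case 1)
  have hP₂ : (α + t) - (a₀ + b₁) ∉ H := by
    intro hP₂
    obtain ⟨bs, hbs, hcs⟩ := hcase
    have hbs' := hbs
    rw [hB, mem_union, mem_singleton] at hbs'
    rcases hbs' with hbsT | hbs1
    · apply hcs b₁ (by rw [hB]; exact mem_union_right _ (mem_singleton_self _))
      have e : a₀ + bs - (α + b₁) = (bs - t) - ((α + b₁) - (a₀ + t)) := by abel
      rw [e]; exact H.sub_mem ((mem_coset_iff hHf).1 (hT hbsT)) hP₁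
    · rw [hbs1] at hcs
      obtain ⟨t₀, ht₀⟩ := hTne
      apply hcs t₀ (by rw [hB]; exact mem_union_left _ ht₀)
      have e : a₀ + b₁ - (α + t₀) = -((α + t) - (a₀ + b₁)) - (t₀ - t) := by abel
      rw [e]; exact H.sub_mem (H.neg_mem hP₂) ((mem_coset_iff hHf).1 (hT ht₀))
  -- the count with three cosets
  have hd1_23 : Disjoint (A₁ + T) (A₁ + {b₁} ∪ (A₀ + T)) :=
    disjoint_union_right.2 ⟨disjoint_of_subset_coset hHf hX₁cos hX₂cos hne12,
      disjoint_of_subset_coset hHf hX₁cos hX₃cos hne13⟩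
  have hd123_4 : Disjoint (A₁ + T ∪ (A₁ + {b₁} ∪ (A₀ + T))) (A₀ + {b₁}) :=
    disjoint_union_left.2 ⟨disjoint_of_subset_coset hHf hX₁cos hX₄cos hP₂,
      disjoint_union_left.2 ⟨disjoint_of_subset_coset hHf hX₂cos hX₄cos hne24,
        disjoint_of_subset_coset hHf hX₃cos hX₄cos hne34⟩⟩
  have hABdec' : A + B = A₁ + T ∪ (A₁ + {b₁} ∪ (A₀ + T)) ∪ (A₀ + {b₁}) := by
    rw [hABdec]; ext y; simp only [mem_union]; tauto
  have hcount : #Hf + #(A₁ + {b₁} ∪ (A₀ + T)) + #A₀ ≤ #A + #B := by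
    have := hAB
    rw [hABdec', card_union_of_disjoint hd123_4, card_union_of_disjoint hd1_23, hX₁card,
      hX₄card] at this
    exact this
  have h23 : #(A₁ + {b₁} ∪ (A₀ + T)) ≤ #A₁ := by omega
  have hX₃sub : A₀ + T ⊆ A₁ + {b₁} := by
    have heq := eq_of_subset_of_card_le (subset_union_left : A₁ + {b₁} ⊆ A₁ + {b₁} ∪ (A₀ + T))
      (by rw [hX₂card]; exact h23)
    rw [heq]; exact subset_union_right
  -- `|A₀| = 1`
  have hA₀one : #A₀ = 1 := by
    have h1 := card_le_card hX₃sub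
    rw [hX₂card] at h1
    by_contra hne
    have h2 : #Hf < #A₀ + #T := by omega
    have h3 := card_le_card (vadd_subset_add_of_card_lt hHf hA₀ hT h2)
    rw [card_vadd_finset] at h3
    omega
  have hA₀eq : A₀ = {x₀} := by
    obtain ⟨y, hy⟩ := card_eq_one.1 hA₀one
    rw [hy] at hx₀; rw [hy, mem_singleton.1 hx₀]
  refine ⟨x₀, hA₀eq, hP₁, hP₂, ?_, hX₁eq⟩
  exact eq_of_subset_of_card_le hX₃sub (by rw [hX₂card]; omega)

/-- **Lemma 5.7, Case 1 — the structure in the two-coset configuration** (`A = A₁ ∪ A₀`,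
`B = B₁ ∪ B₀` as in `case_one_two_by_two`): "by letting `α` be the `H`-hole in `A₁`, and by letting `β`
be the `H`-hole in `B₁`, it follows in view of `A₁ + B₀ = A₀ + B₁` and `|A₁ + B₁| = |H|` that
`|(A ∪ {α}) + (B ∪ {β})| = |A + B| + 1 = |A ∪ {α}| + |B ∪ {β}| − 1`, yielding (17)", and
"`d⊆(B̄, QP) = d⊆(B, QP) = d⊆(Ā, QP) = d⊆(A, QP) = 1` … `d⊆(A + B, QP_H) = d⊆(\overline{A + B}, QP_H) = 1`":
rendered as `(A ∪ {α}) + (B ∪ {β}) = (A + B) ∪ {α + b₁}` with `α + b₁ ∉ A + B` and the three sets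
`A, B, A + B` each `H`-periodic up to one moved element (so that `isPeriodicWith_insert_erase` /
`subsetDist_isQuasiPeriodic_eq_one` apply). [cite: Grynkiewicz2009, Lemma 5.7 (proof, Case 1)] -/
theorem case_one_structure {A A₁ A₀ B T Hf : Finset G} {H : AddSubgroup G} {α a₀ t b₁ : G}
    (hHf : ∀ g, g ∈ Hf ↔ g ∈ H) (hHf3 : 3 ≤ #Hf)
    (hA : A = A₁ ∪ A₀) (hA₁ : A₁ ⊆ α +ᵥ Hf) (hαA₁ : α ∉ A₁) (hA₁card : #A₁ + 1 = #Hf)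
    (hA₀ : A₀ ⊆ a₀ +ᵥ Hf) (hA₀ne : A₀.Nonempty) (hA₀card : #A₀ + 1 ≤ #Hf) (h10 : α - a₀ ∉ H)
    (hB : B = T ∪ {b₁}) (hT : T ⊆ t +ᵥ Hf) (htT : t ∉ T) (hTcard : #T + 1 = #Hf) (hb₁t : b₁ - t ∉ H)
    (hAB : #(A + B) ≤ #A + #B)
    (hcase : ∃ b ∈ B, ∀ b' ∈ B, (a₀ + b) - (α + b') ∉ H) :
    ∃ γ x₀ : G, α ∉ A ∧ t ∉ B ∧ γ ∉ A + B ∧ x₀ ∈ A ∧ b₁ ∈ B ∧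
      insert α A + insert t B = insert γ (A + B) ∧
      IsPeriodicWith H (insert α (A.erase x₀)) ∧ IsPeriodicWith H (insert t (B.erase b₁)) ∧
      IsPeriodicWith H (insert γ ((A + B).erase (x₀ + b₁))) := by
  obtain ⟨x₀, hA₀eq, hP₁, hP₂, hX₃₂, hX₁eq⟩ :=
    case_one_two_by_two hHf hHf3 hA hA₁ hA₁card hA₀ hA₀ne hA₀card h10 hB hT hTcard hb₁t hAB hcase
  have hsing : ∀ {c : G}, ({c} : Finset G) ⊆ c +ᵥ Hf := fun {c} =>
    singleton_subset_iff.2 (mem_coset_self hHf c)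
  have hx₀A₀ : x₀ ∈ A₀ := by rw [hA₀eq]; exact mem_singleton_self x₀
  have hx₀a₀ : x₀ - a₀ ∈ H := (mem_coset_iff hHf).1 (hA₀ hx₀A₀)
  have hA₁A : A₁ ⊆ A := by rw [hA]; exact subset_union_left
  have hx₀A : x₀ ∈ A := by rw [hA]; exact mem_union_right _ hx₀A₀
  have hαA : α ∉ A := by
    rw [hA, mem_union, not_or]
    exact ⟨hαA₁, fun h => h10 ((mem_coset_iff hHf).1 (hA₀ h))⟩
  have hx₀A₁ : x₀ ∉ A₁ := fun h => h10 (by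
    have e : α - a₀ = (x₀ - a₀) - (x₀ - α) := by abel
    rw [e]; exact H.sub_mem hx₀a₀ ((mem_coset_iff hHf).1 (hA₁ h)))
  have hb₁T : b₁ ∉ T := fun h => hb₁t ((mem_coset_iff hHf).1 (hT h))
  have hb₁B : b₁ ∈ B := by rw [hB]; exact mem_union_right _ (mem_singleton_self b₁)
  have hTB : T ⊆ B := by rw [hB]; exact subset_union_left
  have htB : t ∉ B := by
    rw [hB, mem_union, mem_singleton, not_or]
    exact ⟨htT, fun h => hb₁t (by rw [← h, sub_self]; exact H.zero_mem)⟩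
  -- `A + B = (A₁ + T) ∪ {x₀ + b₁} ∪ (A₁ + b₁)`
  have hABdec : A + B = (A₁ + T) ∪ {x₀ + b₁} ∪ (A₁ + {b₁}) := by
    rw [hA, hB, union_add, add_union, add_union, hX₃₂, hA₀eq, singleton_add_singleton]
    ext y; simp only [mem_union, mem_singleton]; tauto
  have hX₂cos : A₁ + {b₁} ⊆ (α + b₁) +ᵥ Hf := add_subset_coset hHf hA₁ hsing
  have hX₁AB : (α + t) +ᵥ Hf ⊆ A + B := by
    rw [← hX₁eq, hABdec]; exact subset_union_left.trans subset_union_left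
  -- `x₀ + b₁` lies in neither of the other two blocks; `α + b₁` is the hole of `A₁ + b₁`
  have hx4_1 : x₀ + b₁ ∉ A₁ + T := fun h => hP₂ (by
    rw [hX₁eq] at h
    have h' := (mem_coset_iff hHf).1 h
    have e : (α + t) - (a₀ + b₁) = (x₀ - a₀) - ((x₀ + b₁) - (α + t)) := by abel
    rw [e]; exact H.sub_mem hx₀a₀ h')
  have hx4_2 : x₀ + b₁ ∉ A₁ + {b₁} := fun h => h10 (by
    have h' := (mem_coset_iff hHf).1 (hX₂cos h)
    have e : α - a₀ = (x₀ - a₀) - ((x₀ + b₁) - (α + b₁)) := by abel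
    rw [e]; exact H.sub_mem hx₀a₀ h')
  have hγX₂ : α + b₁ ∉ A₁ + {b₁} := fun h => by
    obtain ⟨a, ha, b, hb, hab⟩ := mem_add.1 h
    rw [mem_singleton] at hb
    rw [hb] at hab
    apply hαA₁
    rwa [← add_right_cancel hab]
  have hγAB : α + b₁ ∉ A + B := by
    rw [hABdec, mem_union, mem_union, mem_singleton, not_or, not_or, hX₁eq]
    refine ⟨⟨fun h => hb₁t ?_, fun h => hαA ?_⟩, hγX₂⟩
    · have h' := (mem_coset_iff hHf).1 h
      have e : b₁ - t = (α + b₁) - (α + t) := by abel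
      rwa [e]
    · rw [add_right_cancel h]; exact hx₀A
  -- the three sets are `H`-periodic up to one moved element
  have hPA : IsPeriodicWith H (insert α (A.erase x₀)) :=
    isPeriodicWith_insert_erase (P := ∅) (S := A₁) (K := α +ᵥ Hf)
      (by rw [hA, hA₀eq, empty_union, union_comm]) (IsPeriodicWith.empty H) (isPeriodicWith_coset hHf α)
      (notMem_empty _) hx₀A₁ hA₁ (mem_coset_self hHf α) hαA₁ (by rw [card_vadd_finset]; exact hA₁card)
  have hPB : IsPeriodicWith H (insert t (B.erase b₁)) :=
    isPeriodicWith_insert_erase (P := ∅) (S := T) (K := t +ᵥ Hf)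
      (by rw [hB, empty_union, union_comm]) (IsPeriodicWith.empty H) (isPeriodicWith_coset hHf t)
      (notMem_empty _) hb₁T hT (mem_coset_self hHf t) htT (by rw [card_vadd_finset]; exact hTcard)
  have hPC : IsPeriodicWith H (insert (α + b₁) ((A + B).erase (x₀ + b₁))) :=
    isPeriodicWith_insert_erase (P := A₁ + T) (S := A₁ + {b₁}) (K := (α + b₁) +ᵥ Hf)
      hABdec (by rw [hX₁eq]; exact isPeriodicWith_coset hHf _) (isPeriodicWith_coset hHf _)
      hx4_1 hx4_2 hX₂cos (mem_coset_self hHf _) hγX₂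
      (by rw [card_vadd_finset, card_add_singleton]; exact hA₁card)
  -- the sumset identity `(A ∪ {α}) + (B ∪ {t}) = (A + B) ∪ {α + b₁}`
  have heq : insert α A + insert t B = insert (α + b₁) (A + B) := by
    refine Subset.antisymm ?_ (insert_subset (add_mem_add (mem_insert_self α A)
      (mem_insert_of_mem hb₁B)) (add_subset_add (subset_insert _ _) (subset_insert _ _)))
    intro z hz
    obtain ⟨u, hu, v, hv, rfl⟩ := mem_add.1 hz
    rw [mem_insert] at hu hv
    rcases hu with rfl | hu <;> rcases hv with rfl | hv
    · exact mem_insert_of_mem (hX₁AB (mem_coset_self hHf _))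
    · rw [hB, mem_union, mem_singleton] at hv
      rcases hv with hv | rfl
      · exact mem_insert_of_mem (hX₁AB ((mem_coset_iff hHf).2 (by
          have e : u + v - (u + t) = v - t := by abel
          rw [e]; exact (mem_coset_iff hHf).1 (hT hv))))
      · exact mem_insert_self _ _
    · rw [hA, hA₀eq, mem_union, mem_singleton] at hu
      rcases hu with hu | rfl
      · exact mem_insert_of_mem (hX₁AB ((mem_coset_iff hHf).2 (by
          have e : u + v - (α + v) = u - α := by abel
          rw [e]; exact (mem_coset_iff hHf).1 (hA₁ hu))))
      · -- `x₀ + t` is the hole `α + b₁` of the coset of `A₁ + b₁ = x₀ + T`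
        have hcos : u + v ∈ (α + b₁) +ᵥ Hf := (mem_coset_iff hHf).2 (by
          have e : u + v - (α + b₁) = (u - a₀) - ((α + b₁) - (a₀ + v)) := by abel
          rw [e]; exact H.sub_mem hx₀a₀ hP₁)
        have hnot : u + v ∉ A₁ + {b₁} := by
          rw [← hX₃₂, hA₀eq]
          intro h
          obtain ⟨a, ha, b, hb, hab⟩ := mem_add.1 h
          rw [mem_singleton] at ha
          rw [ha] at hab
          apply htT
          rwa [← add_left_cancel hab]
        rw [eq_hole_of_notMem_add hHf hA₁ hαA₁ hA₁card (mem_singleton_self b₁) hcos hnot]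
        exact mem_insert_self _ _
    · exact mem_insert_of_mem (add_mem_add hu hv)
  exact ⟨α + b₁, x₀, hαA, htB, hγAB, hx₀A, hb₁B, heq, hPA, hPB, hPC⟩

/-! ### Lemma 5.7, Case 2 (display (36)): impossible -/

/-- **Lemma 5.7, Case 2 — "`K = G`": `B` meets every `H`-coset.**  In Case 2
("`|φ_H(A) + φ_H(B)| = |φ_H(B)|`"; here: every coset `a₀ + b + H`, `b ∈ B`, is some `α + b′ + H`,
`b′ ∈ B`): "from Kneser's Theorem it follows that `φ_H(B)` is periodic with maximal subgroup `K/H`, and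
that `φ_H(A)` is contained in a `K/H`-coset. Hence, since `⟨A⟩ = G`, it follows that `K = G` and that
`G/H` is cyclic generated by `φ_H(A₁) − φ_H(A₀)`".  Rendered in `G`: `⟨a₀ − α⟩ + H = G` (from `⟨A⟩ = G`,
`0 ∈ A ⊆ (α + H) ∪ (a₀ + H)`), and the set of cosets met by `B` is stable under adding `a₀ − α` (the Case-2
hypothesis) — so it is everything (a coset walk from `0 ∈ B`; Kneser's theorem in `G/H` is not needed for
this rendering). [cite: Grynkiewicz2009, Lemma 5.7 (proof, Case 2)] -/
theorem case_two_cover [Finite G] {A A₁ A₀ B Kf : Finset G} {K : AddSubgroup G} {α a₀ : G}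
    (hKf : ∀ g, g ∈ Kf ↔ g ∈ K) (hA : A = A₁ ∪ A₀) (hA₁ : A₁ ⊆ α +ᵥ Kf) (hA₀ : A₀ ⊆ a₀ +ᵥ Kf)
    (h0A : (0 : G) ∈ A) (h0B : (0 : G) ∈ B) (hgen : AddSubgroup.closure (A : Set G) = ⊤)
    (hcase : ∀ b ∈ B, ∃ b' ∈ B, (a₀ + b) - (α + b') ∈ K) :
    AddSubgroup.zmultiples (a₀ - α) ⊔ K = ⊤ ∧ ∀ g : G, ∃ b ∈ B, b - g ∈ K := by
  have htop : AddSubgroup.zmultiples (a₀ - α) ⊔ K = ⊤ := by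
    rw [eq_top_iff, ← hgen, AddSubgroup.closure_le]
    have hαsup : α ∈ AddSubgroup.zmultiples (a₀ - α) ⊔ K := by
      have h0 := h0A
      rw [hA, mem_union] at h0
      rcases h0 with h0 | h0
      · have : α ∈ K := by
          have := K.neg_mem ((mem_coset_iff hKf).1 (hA₁ h0)); rwa [zero_sub, neg_neg] at this
        exact AddSubgroup.mem_sup_right this
      · have ha₀ : a₀ ∈ K := by
          have := K.neg_mem ((mem_coset_iff hKf).1 (hA₀ h0)); rwa [zero_sub, neg_neg] at this
        have hmem : -(a₀ - α) + a₀ ∈ AddSubgroup.zmultiples (a₀ - α) ⊔ K :=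
          AddSubgroup.add_mem _ (AddSubgroup.mem_sup_left
            (AddSubgroup.neg_mem _ (AddSubgroup.mem_zmultiples _))) (AddSubgroup.mem_sup_right ha₀)
        have e : -(a₀ - α) + a₀ = α := by abel
        rwa [e] at hmem
    intro x hx
    have hx' : x ∈ A := mem_coe.1 hx
    rw [hA, mem_union] at hx'
    rw [SetLike.mem_coe]
    rcases hx' with hx' | hx'
    · have hmem : α + (x - α) ∈ AddSubgroup.zmultiples (a₀ - α) ⊔ K :=
        AddSubgroup.add_mem _ hαsup (AddSubgroup.mem_sup_right ((mem_coset_iff hKf).1 (hA₁ hx')))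
      have e : α + (x - α) = x := by abel
      rwa [e] at hmem
    · have hmem : α + (a₀ - α) + (x - a₀) ∈ AddSubgroup.zmultiples (a₀ - α) ⊔ K :=
        AddSubgroup.add_mem _ (AddSubgroup.add_mem _ hαsup
          (AddSubgroup.mem_sup_left (AddSubgroup.mem_zmultiples _)))
          (AddSubgroup.mem_sup_right ((mem_coset_iff hKf).1 (hA₀ hx')))
      have e : α + (a₀ - α) + (x - a₀) = x := by abel
      rwa [e] at hmem
  refine ⟨htop, forall_of_add_invariant htop (P := fun g => ∃ b ∈ B, b - g ∈ K) ?_ ?_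
    ⟨0, h0B, by rw [sub_zero]; exact K.zero_mem⟩⟩
  · rintro g ⟨b, hb, hbg⟩
    obtain ⟨b', hb', hbb'⟩ := hcase b hb
    refine ⟨b', hb', ?_⟩
    have e : b' - (g + (a₀ - α)) = (b - g) - ((a₀ + b) - (α + b')) := by abel
    rw [e]; exact K.sub_mem hbg hbb'
  · rintro g k hk ⟨b, hb, hbg⟩
    refine ⟨b, hb, ?_⟩
    have e : b - (g + k) = (b - g) - k := by abel
    rw [e]; exact K.sub_mem hbg hk

/-- **Lemma 5.7, Case 2 — display (36).**  With `B` meeting every `H`-coset, `S` the singletons of `B`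
(`c = |S|`), `B′ = B ∖ S`, `ρ′ = |B′ + H| − |B′|`, and `S^×` the singletons `b_i` whose coset
`A₁ + b_i + H` is NOT contained in `A + B`: every element of `\overline{A + B}` is the hole `α + b_i` of
such a coset, so `|\overline{A + B}| ≤ |S^×|`, and counting `G = B + H` gives (36) in the additive form
`c|H| + |B′ + H| + 1 ≤ |H| + |A₀| + c + |B′| + |S^×|`, i.e. "`|A + B| ≥ (l + c)|H| − c ≥ … ≥
|A| + |B| − |A₀| + ρ′ + (c − 1)(|H| − 2) − 1`, with equality possible only if `A₁ + b_i + H ⊄ A + B` for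
`i = 1, …, c`". [cite: Grynkiewicz2009, Lemma 5.7 (proof, Case 2, display (36))] -/
theorem case_two_count [Fintype G] {A A₁ A₀ B Kf S Sx : Finset G} {K : AddSubgroup G} {α a₀ : G}
    (hKf : ∀ g, g ∈ Kf ↔ g ∈ K) (hA : A = A₁ ∪ A₀) (hA₁ : A₁ ⊆ α +ᵥ Kf) (hαA₁ : α ∉ A₁)
    (hA₁card : #A₁ + 1 = #Kf) (hA₀ : A₀ ⊆ a₀ +ᵥ Kf) (h10 : α - a₀ ∉ K)
    (hAB : #(A + B) ≤ #A + #B) (hcov : ∀ g : G, ∃ b ∈ B, b - g ∈ K)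
    (hS : ∀ b, b ∈ S ↔ b ∈ B ∧ ∀ b' ∈ B, b' - b ∈ K → b' = b)
    (hSx : ∀ b, b ∈ Sx ↔ b ∈ S ∧ α + b ∉ A + B) :
    (A + B)ᶜ ⊆ Sx.image (fun b => α + b) ∧
      #S * #Kf + #((B \ S) + Kf) + 1 ≤ #Kf + #A₀ + #S + #(B \ S) + #Sx := by
  have hA₁A : A₁ ⊆ A := by rw [hA]; exact subset_union_left
  have hSB : S ⊆ B := fun b hb => ((hS b).1 hb).1
  have memSx : ∀ {b}, b ∈ Sx ↔ b ∈ S ∧ α + b ∉ A + B := fun {b} => hSx b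
  have hcompl : (A + B)ᶜ ⊆ Sx.image (fun b => α + b) := by
    intro y hy
    rw [mem_compl] at hy
    obtain ⟨b, hb, hbg⟩ := hcov (y - α)
    have hycos : y ∈ (α + b) +ᵥ Kf := (mem_coset_iff hKf).2 (by
      have e : y - (α + b) = -(b - (y - α)) := by abel
      rw [e]; exact K.neg_mem hbg)
    have hyA₁B : y ∉ A₁ + B := fun h => hy (add_subset_add_right hA₁A h)
    have hbS : b ∈ S := by
      by_contra h
      exact hyA₁B (coset_subset_add_of_notMem_singletons hKf hS hA₁ hA₁card hb h hycos)
    have hyeq := eq_hole_of_notMem_add hKf hA₁ hαA₁ hA₁card hb hycos hyA₁B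
    rw [hyeq] at hy ⊢
    exact mem_image_of_mem _ (memSx.2 ⟨hbS, hy⟩)
  refine ⟨hcompl, ?_⟩
  have hBKf : B + Kf = univ := by
    rw [eq_univ_iff_forall]; intro g
    obtain ⟨b, hb, hbg⟩ := hcov g
    exact mem_add.2 ⟨b, hb, g - b, (hKf _).2 (by have := K.neg_mem hbg; rwa [neg_sub] at this),
      by abel⟩
  have hG : #(B + Kf) = #(A + B) + #(A + B)ᶜ := by
    rw [hBKf, card_compl, card_univ]; have := card_le_univ (A + B); omega
  have h1 := (card_le_card hcompl).trans card_image_le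
  have h2 := card_add_coset_eq_of_singletons hKf hS
  have hcardA : #A = #A₁ + #A₀ := by
    rw [hA, card_union_of_disjoint (disjoint_of_subset_coset hKf hA₁ hA₀ h10)]
  have hcardB : #B = #S + #(B \ S) := by
    rw [← card_union_of_disjoint (disjoint_sdiff_self_right), union_sdiff_of_subset hSB]
  omega

/-- **Lemma 5.7, Case 2, `l > 0` is impossible.**  "Suppose `l > 0`. Hence, since
`φ_H(A₁) − φ_H(A₀)` generates `G/H`, and since `c ≥ 3 > 0`, it follows that there exists `b′_j` such that
`φ_H(A₀ + b′_j) = φ_H(A₁ + b_i)` for some `b_i`.  Thus … either `ρ′ ≥ |A₀|`, or else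
`A₁ + b_i + H = A₀ + b′_j + H ⊆ A + B`.  In the former case … `c ≤ 2`, a contradiction.  In the latter
case … (36) is strict and `c ≥ 4` … `2|H| ≤ 5`, contradicting `|H| ≥ 3`."  (The pair `b_i, b′_j` is
found by a coset walk with step `−(a₀ − α)` through the singletons.)
[cite: Grynkiewicz2009, Lemma 5.7 (proof, Case 2)] -/
theorem case_two_l_pos [Finite G] {A A₁ A₀ B Kf S Sx : Finset G} {K : AddSubgroup G} {α a₀ : G}
    (hKf : ∀ g, g ∈ Kf ↔ g ∈ K) (hKf3 : 3 ≤ #Kf)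
    (hA : A = A₁ ∪ A₀) (hA₀ : A₀ ⊆ a₀ +ᵥ Kf) (hA₀card : #A₀ + 1 ≤ #Kf)
    (htop : AddSubgroup.zmultiples (a₀ - α) ⊔ K = ⊤) (hcov : ∀ g : G, ∃ b ∈ B, b - g ∈ K)
    (hS : ∀ b, b ∈ S ↔ b ∈ B ∧ ∀ b' ∈ B, b' - b ∈ K → b' = b)
    (hSx : ∀ b, b ∈ Sx ↔ b ∈ S ∧ α + b ∉ A + B) (hcx3 : 3 ≤ #Sx)
    (h36 : #S * #Kf + #((B \ S) + Kf) + 1 ≤ #Kf + #A₀ + #S + #(B \ S) + #Sx)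
    (hB'ne : (B \ S).Nonempty) : False := by
  have h0Kf : (0 : G) ∈ Kf := (hKf 0).2 K.zero_mem
  have hA₀A : A₀ ⊆ A := by rw [hA]; exact subset_union_right
  have memS : ∀ {b}, b ∈ S ↔ b ∈ B ∧ ∀ b' ∈ B, b' - b ∈ K → b' = b := fun {b} => hS b
  have hSxS : Sx ⊆ S := fun b hb => ((hSx b).1 hb).1
  have memSx : ∀ {b}, b ∈ Sx ↔ b ∈ S ∧ α + b ∉ A + B := fun {b} => hSx b
  have hcxS : #Sx ≤ #S := card_le_card hSxS
  have hS3 : 3 ≤ #S := hcx3.trans hcxS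
  have hρ : #(B \ S) ≤ #((B \ S) + Kf) := card_le_card (subset_add_left _ h0Kf)
  -- a singleton `b` and a non-singleton `b'` with `a₀ + b' ≡ α + b`
  have hpair : ∃ b ∈ S, ∃ b' ∈ B \ S, (a₀ + b') - (α + b) ∈ K := by
    by_contra hno
    push Not at hno
    obtain ⟨b₀, hb₀⟩ : S.Nonempty := card_pos.1 (by omega)
    have hall : ∀ g, ∃ b ∈ S, b - g ∈ K := by
      refine forall_of_add_invariant (K := K) (d := -(a₀ - α)) (by rwa [AddSubgroup.zmultiples_neg])
        (P := fun g => ∃ b ∈ S, b - g ∈ K) ?_ ?_ ⟨b₀, hb₀, by rw [sub_self]; exact K.zero_mem⟩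
      · rintro g ⟨b, hb, hbg⟩
        obtain ⟨b'', hb'', hb''g⟩ := hcov (b - (a₀ - α))
        by_cases hb''S : b'' ∈ S
        · refine ⟨b'', hb''S, ?_⟩
          have e : b'' - (g + -(a₀ - α)) = (b'' - (b - (a₀ - α))) + (b - g) := by abel
          rw [e]; exact K.add_mem hb''g hbg
        · exfalso
          apply hno b hb b'' (mem_sdiff.2 ⟨hb'', hb''S⟩)
          have e : a₀ + b'' - (α + b) = b'' - (b - (a₀ - α)) := by abel
          rw [e]; exact hb''g
      · rintro g k hk ⟨b, hb, hbg⟩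
        refine ⟨b, hb, ?_⟩
        have e : b - (g + k) = (b - g) - k := by abel
        rw [e]; exact K.sub_mem hbg hk
    obtain ⟨b', hb'⟩ := hB'ne
    obtain ⟨b, hb, hbb'⟩ := hall b'
    have := (memS.1 hb).2 b' (mem_sdiff.1 hb').1 (by have := K.neg_mem hbb'; rwa [neg_sub] at this)
    rw [this] at hb'
    exact (mem_sdiff.1 hb').2 hb
  obtain ⟨b, hbS, b', hb', hK⟩ := hpair
  have hb'B : b' ∈ B := (mem_sdiff.1 hb').1
  -- the trace `T'` of `b'` in `B` has at least two elements
  obtain ⟨T', hT'⟩ : ∃ T' : Finset G, T' = B ∩ (b' +ᵥ Kf) := ⟨_, rfl⟩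
  have memT' : ∀ {x}, x ∈ T' ↔ x ∈ B ∧ x ∈ b' +ᵥ Kf := fun {x} => by rw [hT', mem_inter]
  have hT'cos : T' ⊆ b' +ᵥ Kf := fun x hx => (memT'.1 hx).2
  have hT'B : T' ⊆ B := fun x hx => (memT'.1 hx).1
  have hT'2 : 2 ≤ #T' := by
    have hb'S : b' ∉ S := (mem_sdiff.1 hb').2
    rw [hS] at hb'S
    push Not at hb'S
    obtain ⟨b'', hb''B, hbb'', hne⟩ := hb'S hb'B
    have hsub : ({b', b''} : Finset G) ⊆ T' := by
      intro x hx; rw [mem_insert, mem_singleton] at hx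
      rcases hx with rfl | rfl
      · exact memT'.2 ⟨hb'B, mem_coset_self hKf _⟩
      · exact memT'.2 ⟨hb''B, (mem_coset_iff hKf).2 hbb''⟩
    have := card_le_card hsub
    rwa [card_pair hne.symm] at this
  -- the holes of `T'` are holes of `B' = B ∖ S`
  have hholes : #Kf + #(B \ S) ≤ #T' + #((B \ S) + Kf) := by
    have hsub : (b' +ᵥ Kf) \ T' ⊆ ((B \ S) + Kf) \ (B \ S) := by
      intro y hy
      obtain ⟨hycos, hyT'⟩ := mem_sdiff.1 hy
      refine mem_sdiff.2 ⟨coset_subset_add_of_mem hKf (subset_add_left _ h0Kf hb') hycos,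
        fun hyB' => hyT' (memT'.2 ⟨(mem_sdiff.1 hyB').1, hycos⟩)⟩
    have h1 := card_le_card hsub
    rw [card_sdiff_of_subset hT'cos, card_vadd_finset,
      card_sdiff_of_subset (subset_add_left _ h0Kf)] at h1
    have h3 := card_le_card hT'cos
    rw [card_vadd_finset] at h3
    omega
  obtain ⟨p, hp⟩ := Nat.exists_eq_add_of_le hS3
  obtain ⟨q, hq⟩ := Nat.exists_eq_add_of_le hKf3
  have hprod : #S * #Kf = 9 + 3 * p + 3 * q + p * q := by rw [hp, hq]; ring
  have hpq := Nat.zero_le (p * q)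
  by_cases hfull : #Kf < #A₀ + #T'
  · -- the coset `α + b + K = a₀ + b' + K` is filled by `A₀ + T'`: `b ∉ S^×`, so `c ≥ 4`
    have hαb : α + b ∈ A + B := by
      have h1 := vadd_subset_add_of_card_lt hKf hA₀ hT'cos hfull
      have hmem : α + b ∈ (a₀ + b') +ᵥ Kf :=
        (mem_coset_iff hKf).2 (by have := K.neg_mem hK; rwa [neg_sub] at this)
      exact add_subset_add hA₀A hT'B (h1 hmem)
    have hbSx : b ∉ Sx := fun h => (memSx.1 h).2 hαb
    have hcx : #Sx + 1 ≤ #S := by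
      have : Sx ⊂ S := Finset.ssubset_iff_subset_ne.2 ⟨hSxS, fun h => hbSx (by rw [h]; exact hbS)⟩
      have := card_lt_card this
      omega
    obtain ⟨p', hp'⟩ := Nat.exists_eq_add_of_le (show 4 ≤ #S by omega)
    have hprod' : #S * #Kf = 12 + 3 * p' + 4 * q + p' * q := by rw [hp', hq]; ring
    have hpq' := Nat.zero_le (p' * q)
    omega
  · -- `ρ' ≥ |A₀|`: then (36) forces `c ≤ 2`
    omega

omit [AddCommGroup G] in
/-- **Lemma 5.7, Case 2, `l = 0`: the two numerical steps.**  With `c = |B|` and `ρ′ = 0`, (36) reads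
`|B||H| + 1 ≤ |H| + |A₀| + |B| + |S^×|`; then "Suppose `|A₀| ≤ |H| − 2 … `|H| = 3` … `|A| = 3`.  Thus by
hypothesis `c = |B| ≥ 4`, whence (36) implies `|A₀| ≥ 3|H| − 7 ≥ |H| − 1`, a contradiction.  So we can
assume `|A₀| = |H| − 1`.  If `A₁ + b_i + H ⊆ A + B` for some `i`, then (36) will be strict and `c ≥ 4`,
whence `|A₀| ≥ 3|H| − 6 ≥ |H|`, a contradiction."  Conclusion: `|A₀| = |H| − 1` and `S^× = B`.
[cite: Grynkiewicz2009, Lemma 5.7 (proof, Case 2)] -/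
theorem case_two_l_zero_numbers {A A₁ A₀ B Kf Sx : Finset G} (hKf3 : 3 ≤ #Kf)
    (hcardA : #A = #A₁ + #A₀) (hA₁card : #A₁ + 1 = #Kf) (hA₀card : #A₀ + 1 ≤ #Kf)
    (h4 : 4 ≤ #A ∨ 4 ≤ #B) (hcx3 : 3 ≤ #Sx) (hSxB : Sx ⊆ B)
    (h36 : #B * #Kf + 0 + 1 ≤ #Kf + #A₀ + #B + 0 + #Sx) : #A₀ + 1 = #Kf ∧ Sx = B := by
  have hcxB : #Sx ≤ #B := card_le_card hSxB
  have hB3 : 3 ≤ #B := hcx3.trans hcxB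
  obtain ⟨p, hp⟩ := Nat.exists_eq_add_of_le hB3
  obtain ⟨q, hq⟩ := Nat.exists_eq_add_of_le hKf3
  have hprod : #B * #Kf = 9 + 3 * p + 3 * q + p * q := by rw [hp, hq]; ring
  have hpq := Nat.zero_le (p * q)
  have hA₀k : #A₀ + 1 = #Kf := by
    by_contra hne
    omega
  refine ⟨hA₀k, ?_⟩
  by_contra hne
  have hlt : #Sx < #B := card_lt_card (Finset.ssubset_iff_subset_ne.2 ⟨hSxB, hne⟩)
  obtain ⟨p', hp'⟩ := Nat.exists_eq_add_of_le (show 4 ≤ #B by omega)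
  have hprod' : #B * #Kf = 12 + 3 * p' + 4 * q + p' * q := by rw [hp', hq]; ring
  have hpq' := Nat.zero_le (p' * q)
  omega

/-- **Lemma 5.7, Case 2, `l = 0` is impossible.**  "So we may assume `l = 0`, whence `c = |B|`.
Suppose `|A₀| ≤ |H| − 2` … `|H| = 3` … `|A| = 3`.  Thus by hypothesis `c = |B| ≥ 4`, whence (36)
implies `|A₀| ≥ 3|H| − 7 ≥ |H| − 1`, a contradiction.  So we can assume `|A₀| = |H| − 1`.  If
`A₁ + b_i + H ⊆ A + B` for some `i`, then (36) will be strict and `c ≥ 4`, whence `|A₀| ≥ 3|H| − 6 ≥ |H|`,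
a contradiction … since `|A₁| = |A₀| = |H| − 1`, it follows that we can permute the `b_i` such that
`A₁ + b_i = A₀ + b_j` … Consequently `A + B + {b₁, b₂} = … = A + B + b₁`, implying from Kneser's
Theorem that `A + B` is periodic, a contradiction." [cite: Grynkiewicz2009, Lemma 5.7 (proof, Case 2)] -/
theorem case_two_l_zero {A A₁ A₀ B Kf S Sx : Finset G} {K : AddSubgroup G} {α a₀ : G}
    (hKf : ∀ g, g ∈ Kf ↔ g ∈ K) (hKf3 : 3 ≤ #Kf)
    (hA : A = A₁ ∪ A₀) (hA₁ : A₁ ⊆ α +ᵥ Kf) (hA₁card : #A₁ + 1 = #Kf)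
    (hA₀ : A₀ ⊆ a₀ +ᵥ Kf) (hA₀ne : A₀.Nonempty) (hA₀card : #A₀ + 1 ≤ #Kf) (h10 : α - a₀ ∉ K)
    (h4 : 4 ≤ #A ∨ 4 ≤ #B) (h0A : (0 : G) ∈ A) (h0B : (0 : G) ∈ B)
    (haper : (A + B).addStab = {0}) (hcov : ∀ g : G, ∃ b ∈ B, b - g ∈ K)
    (hS : ∀ b, b ∈ S ↔ b ∈ B ∧ ∀ b' ∈ B, b' - b ∈ K → b' = b)
    (hSx : ∀ b, b ∈ Sx ↔ b ∈ S ∧ α + b ∉ A + B) (hcx3 : 3 ≤ #Sx)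
    (h36 : #S * #Kf + #((B \ S) + Kf) + 1 ≤ #Kf + #A₀ + #S + #(B \ S) + #Sx)
    (hB'e : B \ S = ∅) : False := by
  have hA₁A : A₁ ⊆ A := by rw [hA]; exact subset_union_left
  have hA₀A : A₀ ⊆ A := by rw [hA]; exact subset_union_right
  have hSB : S ⊆ B := fun b hb => ((hS b).1 hb).1
  have hSeq : S = B := Subset.antisymm hSB (sdiff_eq_empty_iff_subset.1 hB'e)
  have hSxB : Sx ⊆ B := fun b hb => hSeq ▸ ((hSx b).1 hb).1
  have memSx : ∀ {b}, b ∈ Sx ↔ b ∈ B ∧ α + b ∉ A + B := fun {b} => by rw [hSx, hSeq]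
  have hcxB : #Sx ≤ #B := card_le_card hSxB
  have hcardA : #A = #A₁ + #A₀ := by
    rw [hA, card_union_of_disjoint (disjoint_of_subset_coset hKf hA₁ hA₀ h10)]
  rw [hB'e, empty_add, card_empty, hSeq] at h36
  obtain ⟨hA₀k, hSxeq⟩ := case_two_l_zero_numbers hKf3 hcardA hA₁card hA₀card h4 hcx3 hSxB h36
  have hunc : ∀ b ∈ B, α + b ∉ A + B := fun b hb => (memSx.1 (by rw [hSxeq]; exact hb)).2
  have hsing : ∀ {c : G}, ({c} : Finset G) ⊆ c +ᵥ Kf := fun {c} =>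
    singleton_subset_iff.2 (mem_coset_self hKf c)
  -- "we can permute the `b_i` such that `A₁ + b_i = A₀ + b_j`"
  have hpair : ∀ b ∈ B, ∃ bp ∈ B, A₀ + {b} = A₁ + {bp} := by
    intro b hb
    obtain ⟨bp, hbp, hK⟩ := hcov (b + (a₀ - α))
    refine ⟨bp, hbp, ?_⟩
    have hcoseq : (a₀ + b) +ᵥ Kf = (α + bp) +ᵥ Kf := coset_eq_of_sub_mem hKf (by
      have e : a₀ + b - (α + bp) = -(bp - (b + (a₀ - α))) := by abel
      rw [e]; exact K.neg_mem hK)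
    have hcos1 : A₀ + {b} ⊆ (α + bp) +ᵥ Kf := by
      rw [← hcoseq]; exact add_subset_coset hKf hA₀ hsing
    have hcos2 : A₁ + {bp} ⊆ (α + bp) +ᵥ Kf := add_subset_coset hKf hA₁ hsing
    have hsub1 : A₀ + {b} ⊆ A + B := add_subset_add hA₀A (singleton_subset_iff.2 hb)
    have hsub2 : A₁ + {bp} ⊆ A + B := add_subset_add hA₁A (singleton_subset_iff.2 hbp)
    have hDcard : #((A + B) ∩ ((α + bp) +ᵥ Kf)) + 1 ≤ #Kf := by
      have hsub : (A + B) ∩ ((α + bp) +ᵥ Kf) ⊆ ((α + bp) +ᵥ Kf).erase (α + bp) := fun y hy => by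
        obtain ⟨hy1, hy2⟩ := mem_inter.1 hy
        exact mem_erase.2 ⟨fun h => hunc bp hbp (by rw [← h]; exact hy1), hy2⟩
      have := card_le_card hsub
      rw [card_erase_of_mem (mem_coset_self hKf _), card_vadd_finset] at this
      omega
    have hX2D : A₁ + {bp} ⊆ (A + B) ∩ ((α + bp) +ᵥ Kf) := subset_inter hsub2 hcos2
    have hDeq : A₁ + {bp} = (A + B) ∩ ((α + bp) +ᵥ Kf) :=
      eq_of_subset_of_card_le hX2D (by rw [card_add_singleton]; omega)
    have hX3D : A₀ + {b} ⊆ A₁ + {bp} := by rw [hDeq]; exact subset_inter hsub1 hcos1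
    exact eq_of_subset_of_card_le hX3D (by rw [card_add_singleton, card_add_singleton]; omega)
  -- two elements `b₁ ≠ b₂` of `B` with `A₀ + b₁ = A₁ + b₂`
  obtain ⟨b₂, hb₂, h12⟩ := hpair 0 h0B
  have hb12 : (0 : G) ≠ b₂ := by
    intro h
    rw [← h] at h12
    obtain ⟨x₀, hx₀⟩ := hA₀ne
    have : x₀ + 0 ∈ A₁ + {0} := by rw [← h12]; exact add_mem_add hx₀ (mem_singleton_self _)
    have h1 := (mem_coset_iff hKf).1 (add_subset_coset hKf hA₁ hsing this)
    apply h10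
    have e : α - a₀ = (x₀ - a₀) - ((x₀ + 0) - (α + 0)) := by abel
    rw [e]; exact K.sub_mem ((mem_coset_iff hKf).1 (hA₀ hx₀)) h1
  -- `A + B = A₁ + B`
  have hABA₁ : A + B = A₁ + B := by
    refine Subset.antisymm ?_ (add_subset_add_right hA₁A)
    rw [hA, union_add]
    refine union_subset Subset.rfl fun y hy => ?_
    obtain ⟨x, hx, b, hb, rfl⟩ := mem_add.1 hy
    obtain ⟨bp, hbp, hpb⟩ := hpair b hb
    have : x + b ∈ A₁ + {bp} := by rw [← hpb]; exact add_mem_add hx (mem_singleton_self _)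
    exact add_subset_add_left (singleton_subset_iff.2 hbp) this
  -- `A + B + {0, b₂} = A + B`, contradicting Kneser's theorem and the aperiodicity of `A + B`
  have hsumeq : (A + B) + {0, b₂} = A + B := by
    refine Subset.antisymm (fun z hz => ?_) (fun z hz => mem_add.2 ⟨z, hz, 0, mem_insert_self _ _, add_zero z⟩)
    obtain ⟨y, hy, w, hw, rfl⟩ := mem_add.1 hz
    rw [mem_insert, mem_singleton] at hw
    rcases hw with rfl | rfl
    · rwa [add_zero]
    · rw [hABA₁] at hy ⊢
      obtain ⟨x, hx, b, hb, rfl⟩ := mem_add.1 hy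
      have hxb₂ : x + w ∈ A₀ + {0} := by rw [h12]; exact add_mem_add hx (mem_singleton_self _)
      obtain ⟨x', hx', u, hu, he⟩ := mem_add.1 hxb₂
      rw [mem_singleton] at hu
      rw [hu, add_zero] at he
      -- `x + b + w = x' + b` with `x' ∈ A₀`: use the pairing for `b`
      obtain ⟨bp, hbp, hpb⟩ := hpair b hb
      have : x' + b ∈ A₁ + {bp} := by rw [← hpb]; exact add_mem_add hx' (mem_singleton_self _)
      have e : x + b + w = x' + b := by rw [he]; abel
      rw [e]
      exact add_subset_add_left (singleton_subset_iff.2 hbp) this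
  have hABne : (A + B).Nonempty := ⟨0 + 0, add_mem_add h0A h0B⟩
  have hkn := card_add_card_le_card_add_add_card_addStab (A + B) {0, b₂} hABne
    ⟨0, mem_insert_self _ _⟩
  rw [card_pair hb12, hsumeq, haper, card_singleton] at hkn
  omega

/-- **Lemma 5.7, Case 2 is impossible** (assembly of `case_two_cover`, `case_two_count`,
`case_two_l_pos`, `case_two_l_zero`): in the two-coset setting `A = A₁ ∪ A₀` (`|A₁| = |H| − 1`,
`1 ≤ |A₀| ≤ |H| − 1`, distinct cosets, `|H| ≥ 3`) with `⟨A⟩ = G`, `0 ∈ A ∩ B`, `|A| ≥ 4` or `|B| ≥ 4`,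
`|A + B| = |A| + |B|`, `A + B` aperiodic with `|\overline{A + B}| ≥ 3`, the Case-2 hypothesis
"`|φ_H(A) + φ_H(B)| = |φ_H(B)|`" cannot hold. [cite: Grynkiewicz2009, Lemma 5.7 (proof, Case 2)] -/
theorem case_two_false [Fintype G] {A A₁ A₀ B Kf : Finset G} {K : AddSubgroup G} {α a₀ : G}
    (hKf : ∀ g, g ∈ Kf ↔ g ∈ K) (hKf3 : 3 ≤ #Kf)
    (hA : A = A₁ ∪ A₀) (hA₁ : A₁ ⊆ α +ᵥ Kf) (hαA₁ : α ∉ A₁) (hA₁card : #A₁ + 1 = #Kf)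
    (hA₀ : A₀ ⊆ a₀ +ᵥ Kf) (hA₀ne : A₀.Nonempty) (hA₀card : #A₀ + 1 ≤ #Kf) (h10 : α - a₀ ∉ K)
    (h4 : 4 ≤ #A ∨ 4 ≤ #B) (h0A : (0 : G) ∈ A) (h0B : (0 : G) ∈ B)
    (hgen : AddSubgroup.closure (A : Set G) = ⊤)
    (hAB : #(A + B) = #A + #B) (haper : (A + B).addStab = {0}) (hC3 : 3 ≤ #(A + B)ᶜ)
    (hcase : ∀ b ∈ B, ∃ b' ∈ B, (a₀ + b) - (α + b') ∈ K) : False := by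
  obtain ⟨htop, hcov⟩ := case_two_cover hKf hA hA₁ hA₀ h0A h0B hgen hcase
  obtain ⟨S, hSdef⟩ : ∃ S : Finset G, S = B.filter (fun b => ∀ b' ∈ B, b' - b ∈ Kf → b' = b) :=
    ⟨_, rfl⟩
  have hS : ∀ b, b ∈ S ↔ b ∈ B ∧ ∀ b' ∈ B, b' - b ∈ K → b' = b := fun b => by
    rw [hSdef, mem_filter]
    refine and_congr_right fun _ => forall₂_congr fun b' _ => ?_
    rw [hKf]
  obtain ⟨Sx, hSxdef⟩ : ∃ Sx : Finset G, Sx = S.filter (fun b => α + b ∉ A + B) := ⟨_, rfl⟩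
  have hSx : ∀ b, b ∈ Sx ↔ b ∈ S ∧ α + b ∉ A + B := fun b => by rw [hSxdef, mem_filter]
  obtain ⟨hcompl, h36⟩ :=
    case_two_count hKf hA hA₁ hαA₁ hA₁card hA₀ h10 hAB.le hcov hS hSx
  have hcx3 : 3 ≤ #Sx := hC3.trans ((card_le_card hcompl).trans card_image_le)
  rcases (B \ S).eq_empty_or_nonempty with hB'e | hB'ne
  · exact case_two_l_zero hKf hKf3 hA hA₁ hA₁card hA₀ hA₀ne hA₀card h10 h4 h0A h0B haper hcov
      hS hSx hcx3 h36 hB'e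
  · exact case_two_l_pos hKf hKf3 hA hA₀ hA₀card htop hcov hS hSx hcx3 h36 hB'ne

/-! ### Lemma 5.7 -/

/-- **Grynkiewicz 2009, Lemma 5.7.**  "Let `A` and `B` be nonempty subsets of a finite abelian group
`G` with `|A + B| = |A| + |B|`, `0 ∈ A ∩ B`, `|A|, |B|, d⊆(A + B, P) ≥ 3`, `(A, B)` non-extendible, and
`⟨A⟩ = G`.  If `d⊆(A, QP) = 1` and either `|A| ≥ 4` or `|B| ≥ 4`, then `d⊆(C, QP) = 1` for all
`C ∈ {A, B, A + B, Ā, B̄, \overline{A + B}}` and (17) holds."  Rendering: `d⊆(A + B, P) ≥ 3` unfolded as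
"every periodic superset of `A + B` has at least three more elements"; `d⊆(A, QP) = 1` unfolded as
"`A` is not quasi-periodic and `A ∪ {α}` is quasi-periodic for some `α ∉ A`" (`subsetDist_eq_one_iff`;
the `d⊆` form is `subsetDist_eq_one_and_seventeen_of_subsetDist_eq_one`); `QP` = `{P | IsQuasiPeriodic P}`,
`d⊆` = `subsetDist`; the six sets as a `∀` over a `Finset (Finset G)`; (17) as
`|(A ∪ {α}) + (B ∪ {β})| + 1 = |A ∪ {α}| + |B ∪ {β}|`.  PROOF AS PRINTED (pp. 19–20): the reduction
`shape_of_insert_isQuasiPeriodic` ("the proof is complete unless `A = A₁ ∪ A₀` …", Lemma 5.6 via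
`lemma56_of_periodic_union` otherwise), "If `A₀` is empty, then `⟨A⟩ = G` implies `H = G` …", `|H| ≥ 3`,
Lemma 5.4 (`not_isQuasiPeriodic_six`); Case 1 (`case_one_core`: (35) and its case analysis, the exits
"covered by Lemma 5.6" through `lemma56_of_periodic_union` for the pair `(B, A)`, and the final two-coset
configuration `case_one_structure`); Case 2 impossible (`case_two_false`: (36)).  Deviation: in the last
sub-case of Case 1 print obtains `|A₀| = 1` "by the above argument" applied to `(B, A)`; here it is read
off the same four-block count that print uses in the next sentence (`case_one_two_by_two`).
[cite: Grynkiewicz2009, Lemma 5.7] -/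
theorem subsetDist_eq_one_and_seventeen_of_insert_isQuasiPeriodic [Fintype G] {A B : Finset G}
    {α : G} (hA3 : 3 ≤ #A) (hB3 : 3 ≤ #B) (h4 : 4 ≤ #A ∨ 4 ≤ #B)
    (h0A : (0 : G) ∈ A) (h0B : (0 : G) ∈ B) (hAB : #(A + B) = #A + #B)
    (hP3 : ∀ P : Finset G, A + B ⊆ P → P.addStab ≠ {0} → 3 ≤ #(P \ (A + B)))
    (hneA : IsNonExtendible A B) (hneB : IsNonExtendible B A)
    (hgen : AddSubgroup.closure (A : Set G) = ⊤)
    (hAqp : ¬ IsQuasiPeriodic A) (hα : α ∉ A) (hαqp : IsQuasiPeriodic (insert α A)) :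
    (∀ C ∈ ({A, B, A + B, Aᶜ, Bᶜ, (A + B)ᶜ} : Finset (Finset G)),
        subsetDist C {P | IsQuasiPeriodic P} = 1) ∧
      ∃ α β : G, #(insert α A + insert β B) + 1 = #(insert α A) + #(insert β B) := by
  classical
  have hBne : B.Nonempty := ⟨0, h0B⟩
  have hα0 : α ≠ 0 := fun h => hα (by rw [h]; exact h0A)
  -- `A + B` is aperiodic and its complement has at least three elements
  have haper : (A + B).addStab = {0} := by
    by_contra hne
    have := hP3 (A + B) Subset.rfl hne
    rw [Finset.sdiff_self, card_empty] at this
    omega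
  have hC3 : 3 ≤ #(A + B)ᶜ := by
    have hst : (univ : Finset G).addStab ≠ {0} := by
      intro heq
      have : α ∈ (univ : Finset G).addStab := (mem_addStab univ_nonempty).2 vadd_finset_univ
      rw [heq, mem_singleton] at this
      exact hα0 this
    have := hP3 univ (subset_univ _) hst
    rwa [← compl_eq_univ_sdiff] at this
  obtain ⟨hBqp, hABqp, hAcqp, hBcqp, hABcqp, hgenB⟩ :=
    not_isQuasiPeriodic_six hA3 hB3 hC3 h0A h0B hAB haper hneA hneB hgen hAqp
  -- the same data for the pair `(B, A)`
  have hBA : #(B + A) = #B + #A := by rw [add_comm, hAB, add_comm]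
  have hP3' : ∀ P : Finset G, B + A ⊆ P → P.addStab ≠ {0} → 3 ≤ #(P \ (B + A)) := by
    intro P; rw [add_comm]; exact hP3 P
  have finishB : ∀ {P S₁ S₂ : Finset G} {H : AddSubgroup G}, B = P ∪ S₁ ∪ S₂ → P.Nonempty →
      H ≠ ⊥ → IsPeriodicWith H P → (∀ x ∈ S₁, ∀ y ∈ S₁, x - y ∈ H) →
      (∀ x ∈ S₂, ∀ y ∈ S₂, x - y ∈ H) →
      (∀ C ∈ ({A, B, A + B, Aᶜ, Bᶜ, (A + B)ᶜ} : Finset (Finset G)),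
          subsetDist C {P | IsQuasiPeriodic P} = 1) ∧
        ∃ α β : G, #(insert α A + insert β B) + 1 = #(insert α A) + #(insert β B) := by
    intro P S₁ S₂ H hB hPne hH hP hS₁ hS₂
    obtain ⟨h6, β, α', h17⟩ := lemma56_of_periodic_union hB hPne hH hP hS₁ hS₂ hB3 hA3 h0B h0A hBA
      hP3' hneB hneA hgenB hBqp
    refine ⟨fun C hC => h6 C (mem_six_comm.2 hC), α', β, ?_⟩
    rw [add_comm (insert α' A), add_comm #(insert α' A)]; exact h17
  -- the reduction: `A = P ∪ ((α + K) ∖ {α}) ∪ A₀`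
  obtain ⟨K, Kf, P, A₀, hK, hKf, hPper, hA₀, -, -, hAdec⟩ :=
    shape_of_insert_isQuasiPeriodic hα hαqp hAqp
  obtain ⟨A₁, hA₁def⟩ : ∃ A₁ : Finset G, A₁ = (α +ᵥ Kf).erase α := ⟨_, rfl⟩
  rw [← hA₁def] at hAdec
  have hA₁ : A₁ ⊆ α +ᵥ Kf := by rw [hA₁def]; exact erase_subset _ _
  have hαA₁ : α ∉ A₁ := by rw [hA₁def]; exact notMem_erase _ _
  have hA₁card : #A₁ + 1 = #Kf := by
    rw [hA₁def, card_erase_add_one (mem_coset_self hKf α), card_vadd_finset]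
  have hA₁pair : ∀ x ∈ A₁, ∀ y ∈ A₁, x - y ∈ K := fun x hx y hy => by
    have := K.sub_mem ((mem_coset_iff hKf).1 (hA₁ hx)) ((mem_coset_iff hKf).1 (hA₁ hy))
    rwa [sub_sub_sub_cancel_right] at this
  rcases P.eq_empty_or_nonempty with hPe | hPne
  swap
  · -- "In view of Lemma 5.6, it follows the proof is complete unless `A = A₁ ∪ A₀` …"
    exact lemma56_of_periodic_union hAdec hPne hK hPper hA₁pair hA₀ hA3 hB3 h0A h0B hAB hP3 hneA
      hneB hgen hAqp
  rw [hPe, empty_union] at hAdec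
  have hA₁A : A₁ ⊆ A := by rw [hAdec]; exact subset_union_left
  -- "If `A₀` is empty, then `⟨A⟩ = G` implies that `H = G`, whence `|A| = |G| − 1`, contradicting
  -- `d⊆(A + B, P) ≥ 3`" — and likewise if `A₀` lies in the coset `α + H`
  have key : ∃ x₀ ∈ A₀, x₀ - α ∉ K := by
    by_contra hno
    push Not at hno
    have hAcos : A ⊆ α +ᵥ Kf := by
      rw [hAdec]; exact union_subset hA₁ (fun x hx => (mem_coset_iff hKf).2 (hno x hx))
    have hαK : α ∈ K := by
      have := K.neg_mem ((mem_coset_iff hKf).1 (hAcos h0A)); rwa [zero_sub, neg_neg] at this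
    have hAK : (A : Set G) ⊆ K := fun x hx => by
      have h1 := (mem_coset_iff hKf).1 (hAcos (mem_coe.1 hx))
      have e : x = (x - α) + α := by abel
      rw [SetLike.mem_coe, e]; exact K.add_mem h1 hαK
    have hKtop : K = ⊤ := by rw [eq_top_iff, ← hgen]; exact (AddSubgroup.closure_le K).2 hAK
    have hKf_univ : Kf = univ :=
      eq_univ_iff_forall.2 fun g => (hKf g).2 (by rw [hKtop]; exact AddSubgroup.mem_top g)
    have h1 : #A₁ + 1 = Fintype.card G := by rw [hA₁card, hKf_univ, card_univ]
    have h2 : #A ≤ #(A + B) := card_le_card (subset_add_left A h0B)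
    have h3 : #A₁ ≤ #A := card_le_card hA₁A
    have h4' : #(A + B)ᶜ + #(A + B) = Fintype.card G := by
      rw [card_compl]; have := card_le_univ (A + B); omega
    omega
  obtain ⟨a₀, ha₀A₀, ha₀⟩ := key
  have h10 : α - a₀ ∉ K := fun h => ha₀ (by have := K.neg_mem h; rwa [neg_sub] at this)
  have hA₀cos : A₀ ⊆ a₀ +ᵥ Kf := fun x hx => (mem_coset_iff hKf).2 (hA₀ x hx a₀ ha₀A₀)
  have hA₀ne : A₀.Nonempty := ⟨a₀, ha₀A₀⟩
  -- "`|A₀| < |H|`" (else `A` is quasi-periodic) and "`|H| ≥ 3`"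
  have hA₀card : #A₀ + 1 ≤ #Kf := by
    by_contra hlt
    have hfull : A₀ = a₀ +ᵥ Kf := eq_of_subset_of_card_le hA₀cos (by rw [card_vadd_finset]; omega)
    apply hAqp
    rw [hAdec, union_comm]
    refine isQuasiPeriodic_union_of_isPeriodicWith hK ?_ hA₀ne hA₁pair
    rw [hfull]; exact isPeriodicWith_coset hKf a₀
  have hKf3 : 3 ≤ #Kf := by
    have : #A = #A₁ + #A₀ := by
      rw [hAdec, card_union_of_disjoint (disjoint_of_subset_coset hKf hA₁ hA₀cos h10)]
    omega
  -- Case 1 / Case 2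
  by_cases hcase : ∃ b ∈ B, ∀ b' ∈ B, (a₀ + b) - (α + b') ∉ K
  · rcases case_one_core hKf hKf3 hAdec hA₁ hαA₁ hA₁card hA₀cos h10 hB3 hAB.le hneA hcase with
      ⟨P', S₁, S₂, hBdec, hP'ne, hP'per, hS₁, hS₂⟩ | ⟨T, t, b₁, hBdec, hT, htT, hTcard, hb₁t⟩
    · -- "covered by Lemma 5.6" (for the pair `(B, A)`)
      exact finishB hBdec hP'ne hK hP'per hS₁ hS₂
    · obtain ⟨γ, x₀, hαA, htB, hγAB, hx₀A, hb₁B, heq, hPA, hPB, hPC⟩ :=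
        case_one_structure hKf hKf3 hAdec hA₁ hαA₁ hA₁card hA₀cos hA₀ne hA₀card h10 hBdec hT htT
          hTcard hb₁t hAB.le hcase
      have hxt : x₀ + b₁ ∈ A + B := add_mem_add hx₀A hb₁B
      refine ⟨fun C hC => ?_, α, t, ?_⟩
      · simp only [mem_insert, mem_singleton] at hC
        rcases hC with rfl | rfl | rfl | rfl | rfl | rfl
        · exact (subsetDist_isQuasiPeriodic_eq_one hK hx₀A hαA hPA hAqp).2
        · exact (subsetDist_isQuasiPeriodic_eq_one hK hb₁B htB hPB hBqp).2
        · exact (subsetDist_isQuasiPeriodic_eq_one hK hxt hγAB hPC hABqp).2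
        · exact (subsetDist_isQuasiPeriodic_compl_eq_one hK hx₀A hαA hPA hAcqp).2
        · exact (subsetDist_isQuasiPeriodic_compl_eq_one hK hb₁B htB hPB hBcqp).2
        · exact (subsetDist_isQuasiPeriodic_compl_eq_one hK hxt hγAB hPC hABcqp).2
      · rw [heq, card_insert_of_notMem hγAB, card_insert_of_notMem hαA, card_insert_of_notMem htB,
          hAB]
        omega
  · push Not at hcase
    exact (case_two_false hKf hKf3 hAdec hA₁ hαA₁ hA₁card hA₀cos hA₀ne hA₀card h10 h4 h0A h0B hgen
      hAB haper hC3 hcase).elim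

/-- **Grynkiewicz 2009, Lemma 5.7**, with the hypothesis in the printed form `d⊆(A, QP) = 1`
(`subsetDist A {P | IsQuasiPeriodic P} = 1`). [cite: Grynkiewicz2009, Lemma 5.7] -/
theorem subsetDist_eq_one_and_seventeen_of_subsetDist_eq_one [Fintype G] {A B : Finset G}
    (hA3 : 3 ≤ #A) (hB3 : 3 ≤ #B) (h4 : 4 ≤ #A ∨ 4 ≤ #B)
    (h0A : (0 : G) ∈ A) (h0B : (0 : G) ∈ B) (hAB : #(A + B) = #A + #B)
    (hP3 : ∀ P : Finset G, A + B ⊆ P → P.addStab ≠ {0} → 3 ≤ #(P \ (A + B)))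
    (hneA : IsNonExtendible A B) (hneB : IsNonExtendible B A)
    (hgen : AddSubgroup.closure (A : Set G) = ⊤)
    (hd : subsetDist A {P | IsQuasiPeriodic P} = 1) :
    (∀ C ∈ ({A, B, A + B, Aᶜ, Bᶜ, (A + B)ᶜ} : Finset (Finset G)),
        subsetDist C {P | IsQuasiPeriodic P} = 1) ∧
      ∃ α β : G, #(insert α A + insert β B) + 1 = #(insert α A) + #(insert β B) := by
  obtain ⟨hAqp, α, hα, hαqp⟩ := subsetDist_eq_one_iff.1 hd
  exact subsetDist_eq_one_and_seventeen_of_insert_isQuasiPeriodic hA3 hB3 h4 h0A h0B hAB hP3 hneA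
    hneB hgen hAqp hα hαqp

end Grynkiewicz2009

end Literature.Combinatorics.Additive
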